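import Literature.Topology.FourManifolds.CappellShanesonClassGroupFifteen
import Literature.Topology.FourManifolds.CappellShanesonIdealCertificates
import HarnessLib

/-!
# The class group of the trace `23` field (discriminant `173857 = 23 · 7559`) and Gompf's conjecture
# for the traces `23` and `-18` (Kim–Yamada 2023, Theorem B)

Serves the named fact
`Literature.Topology.FourManifolds.kimYamada2023_nonempty_diffeomorph_sphere_four_of_trace_mem_Icc`
(`CappellShaneson.lean`; M. H. Kim, S. Yamada, Kyungpook Math. J. 63 (2023) 373–411 =
arXiv:1707.03860, Cor. C), reduced in the tree to Gompf's topological leaves and Theorem B in matrix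
form (`GompfConjectureForTrace n`) for the traces not yet proved. This file PROVES Theorem B for the
trace `23` (class group cyclic of order dividing `5`): `C(ℤ[Θ₂₃])` is covered by the representatives
`(1, 1, 23)`, `(3, 5, 23)`, `(6, 13, 23)`, `(5, 11, 23)`, `(4, 7, 23)`, which move by Gompf moves to the
traces `23`, `8`, `10`, `1`, `9` (Lemma 6.1 / §6.1), where Gompf's conjecture holds — and, by Theorem A,
for `-18 = 5 - 23`.

## The number theory

For a cubic number field `K` generated by a root `θ` of `f₂₃ = x³ - 23x² + 22x - 1`:

* `Δ(f₂₃) = 173857 = 23 · 7559` is squarefree, so `𝓞 K = ℤ[θ]`, `d_K = 173857`, `⌊M_K⌋ ≤ 118`;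
* Dedekind–Kummer at `p ≤ 118` (Marcus, Ch. 3, Thm. 27): `2, 3, 17, 19, 53, 67, 71, 89, 97` are inert;
  `f₂₃ ≡ (x - 3)(x² + 2) (mod 5)`, `f₂₃ ≡ (x - 4)(x² + 2x + 2) (mod 7)`; `f₂₃ ≡ (x - 3)(x - 10)² (mod 23)`
  (ramified); `31, 47, 101, 107, 113` split; unique roots `5, 6, 27, 6, 2, 40, 39, 39, 51, 19, 68, 69, 32`
  modulo `11, 13, 29, 37, 41, 43, 59, 61, 73, 79, 83, 103, 109`;
* `a = [𝔭₅]`, `𝔭₅ = (5, θ - 3)`, satisfies `a⁵ = 1` (relations in the theorem's docstring), and every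
  other small prime is a power of `a` by an explicit relation with certified cofactors:
  `𝔭₅ 𝔭₇ = (2θ - 1)`, `𝔭₅ 𝔮₂₅ = (5)`, `𝔭₇ 𝔮₄₉ = (7)`, `𝔭₅ (23, θ - 3) = (θ - 3)`,
  `(23, θ - 10)(47, θ - 10) = (θ - 10)`, `𝔭₁₁ (47, θ - 10) = (5θ - 3)`, `𝔭₅ 𝔭₂₉ = (θ + 2)`,
  `𝔭₇ (31, θ - 4) = (θ - 4)`, `𝔭₁₁ (31, θ - 5) = (θ - 5)`, `𝔭₁₁ (31, θ - 14) = (θ² - 3θ + 1)`,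
  `𝔭₁₃ 𝔭₃₇ = (θ - 6)`, `𝔭₄₁ = (θ - 2)`, `𝔭₇ 𝔭₄₃ = (θ + 3)`, `𝔭₁₃ (47, θ - 14) = (θ² - 4θ + 1)`,
  `(47, θ - 46) = (θ + 1)`, `𝔭₅ 𝔭₅₉ = (3θ + 1)`, `𝔭₁₁ 𝔭₆₁ = (8θ - 7)`, `𝔭₁₁ 𝔭₇₃ = (θ² + 2θ - 2)`,
  `𝔭₁₃ 𝔭₇₉ = (θ - 19)`, `𝔭₁₃ 𝔭₈₃ = (11θ - 1)`, `𝔭₅ (101, θ - 23) = (θ² - θ - 1)`, `𝔭₇ (101, θ - 33) =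
  (3θ + 2)`, `(101, θ - 68) = (3θ - 2)`, `𝔭₁₀₃ = (3θ - 1)`, `𝔭₇ (107, θ - 44) = (5θ - 6)`,
  `𝔭₁₁ (107, θ - 92) = (7θ - 2)`, `𝔭₁₁ (107, θ - 101) = (θ + 6)`, `𝔭₅ 𝔭₁₀₉ = (7θ - 6)`,
  `𝔭₇ (113, θ - 26) = (9θ - 8)`, `𝔭₇ (113, θ - 45) = (5θ + 1)`, `𝔭₁₃ (113, θ - 65) = (7θ - 3)`;
* hence every ideal class is one of `a⁰, …, a⁴` (`classGroup_mem_five_twentythree`).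

Transport to `ℤ[X]/(f₂₃)` and Prop. 2.14 (`exists_isConj_standardCSMatrix_of_cover`):
`isConj_standardCSMatrix_of_trace_eq_twentythree`, `gompfConjectureForTrace_twentythree`,
`gompfConjectureForTrace_neg_eighteen`. No named fact is introduced (D-0026).

## References

* [KimYamada2023] M. H. Kim, S. Yamada, Kyungpook Math. J. 63 (2023) 373–411 (arXiv:1707.03860):
  §2.3 (Prop. 2.14), §5 (Table 2), §6.1 (Lemma 6.1 and the proof of Thm. B), Thm. A.
* [Marcus2018] D. A. Marcus, *Number Fields*, 2nd ed., Ch. 3, Thm. 27 (Dedekind–Kummer); Ch. 5,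
  Cor. 2 of Thm. 37 (Minkowski bound).
-/

noncomputable section

open Set Polynomial Module NumberField Ideal
open scoped NumberField MatrixGroups nonZeroDivisors
open Literature.LinearAlgebra.Matrix

namespace Literature.Topology.FourManifolds


section Field

variable {K : Type*} [Field K] [NumberField K] {θ : K}

/-! ### Discriminant `173857` and `𝓞 K = ℤ[θ]` -/

/-- `Δ(f₂₃) = 23·21·20·18 - 23 = 173857`. [cite: KimYamada2023, §3 (Δ(fₙ) = n(n-2)(n-3)(n-5) - 23)] -/
theorem csDisc_twentythree : csDisc 23 = 173857 := by
  decide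

set_option maxRecDepth 8192 in
/-- `173857 = 23 · 7559` is squarefree, so `Δ(f₂₃)` has no factorisation `r² e` with `|e| > 2`,
`r ≠ ±1`, and `𝓞 K = ℤ[θ]`. [folklore] -/
theorem csDisc_twentythree_sq : ∀ r e : ℤ, csDisc 23 = r ^ 2 * e → 2 < |e| → IsUnit r :=
  isUnit_of_eq_sq_mul (B := 416) (by decide) (by decide) (by decide)

/-- `d_K = 173857` for the trace `23` field. [folklore] -/
theorem discr_eq_twentythree (hθ : aeval θ (csPoly 23) = 0) (h3 : finrank ℚ K = 3) :
    NumberField.discr K = 173857 := by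
  rw [discr_eq_csDisc_of_sq hθ h3 csDisc_twentythree_sq, csDisc_twentythree]

/-- The cubic relation `θ³ - 23θ² + 22θ - 1 = 0` in `𝓞 K`. [folklore] -/
theorem thetaInt_rel_twentythree (hθ : aeval θ (csPoly 23) = 0) :
    (thetaInt hθ) ^ 3 - 23 * (thetaInt hθ) ^ 2 + 22 * thetaInt hθ - 1 = 0 := by
  have rel := thetaInt_rel hθ
  push_cast at rel
  linear_combination rel

/-! ### The primes of norm at most `118` (Dedekind–Kummer) -/

set_option maxRecDepth 16384 in
/-- The inert primes `2, 3, 17, 19, 53, 67, 71, 89, 97` (no root of `f₂₃`): every prime above them is `(p)`. [folklore] -/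
theorem eq_span_of_inert_twentythree (hθ : aeval θ (csPoly 23) = 0) (h3 : finrank ℚ K = 3) {p : ℕ}
    (hp : p = 2 ∨ p = 3 ∨ p = 17 ∨ p = 19 ∨ p = 53 ∨ p = 67 ∨ p = 71 ∨ p = 89 ∨ p = 97)
    {P : Ideal (𝓞 K)} (hP : P ∈ primesOver (span {(p : ℤ)}) (𝓞 K)) : P = span {(p : 𝓞 K)} := by
  rcases hp with rfl | rfl | rfl | rfl | rfl | rfl | rfl | rfl | rfl
  · exact eq_span_of_no_root_of_sq hθ h3 csDisc_twentythree_sq (by norm_num) hP (by decide)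
  · exact eq_span_of_no_root_of_sq hθ h3 csDisc_twentythree_sq (by norm_num) hP (by decide)
  · exact eq_span_of_no_root_of_sq hθ h3 csDisc_twentythree_sq (by norm_num) hP (by decide)
  · exact eq_span_of_no_root_of_sq hθ h3 csDisc_twentythree_sq (by norm_num) hP (by decide)
  · exact eq_span_of_no_root_of_sq hθ h3 csDisc_twentythree_sq (by norm_num) hP (by decide)
  · exact eq_span_of_no_root_of_sq hθ h3 csDisc_twentythree_sq (by norm_num) hP (by decide)
  · exact eq_span_of_no_root_of_sq hθ h3 csDisc_twentythree_sq (by norm_num) hP (by decide)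
  · exact eq_span_of_no_root_of_sq hθ h3 csDisc_twentythree_sq (by norm_num) hP (by decide)
  · exact eq_span_of_no_root_of_sq hθ h3 csDisc_twentythree_sq (by norm_num) hP (by decide)

set_option maxRecDepth 16384 in
/-- The degree-one primes at primes with a unique root of `f₂₃`: `(11, θ - 5)`, `(13, θ - 6)`, `(29, θ - 27)`, `(37, θ - 6)`, `(41, θ - 2)`, `(43, θ - 40)`, `(59, θ - 39)`, `(61, θ - 39)`, `(73, θ - 51)`, `(79, θ - 19)`, `(83, θ - 68)`, `(103, θ - 69)`, `(109, θ - 32)` are the only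
primes `P` above them with `p ^ {f_P} ≤ 118`. [folklore] -/
theorem eq_span_pair_of_unique_root_twentythree (hθ : aeval θ (csPoly 23) = 0) (h3 : finrank ℚ K = 3)
    {p : ℕ} {c₀ : ℤ}
    (hp : (p = 11 ∧ c₀ = 5) ∨ (p = 13 ∧ c₀ = 6) ∨ (p = 29 ∧ c₀ = 27) ∨ (p = 37 ∧ c₀ = 6) ∨ (p = 41 ∧ c₀ = 2) ∨ (p = 43 ∧ c₀ = 40) ∨ (p = 59 ∧ c₀ = 39) ∨ (p = 61 ∧ c₀ = 39) ∨ (p = 73 ∧ c₀ = 51) ∨ (p = 79 ∧ c₀ = 19) ∨ (p = 83 ∧ c₀ = 68) ∨ (p = 103 ∧ c₀ = 69) ∨ (p = 109 ∧ c₀ = 32))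
    {P : Ideal (𝓞 K)} (hP : P ∈ primesOver (span {(p : ℤ)}) (𝓞 K)) (hle : p ^ P.inertiaDeg ℤ ≤ 118) :
    P = span {(p : 𝓞 K), thetaInt hθ - (c₀ : 𝓞 K)} := by
  rcases hp with ⟨rfl, rfl⟩ | ⟨rfl, rfl⟩ | ⟨rfl, rfl⟩ | ⟨rfl, rfl⟩ | ⟨rfl, rfl⟩ | ⟨rfl, rfl⟩ | ⟨rfl, rfl⟩ | ⟨rfl, rfl⟩ | ⟨rfl, rfl⟩ | ⟨rfl, rfl⟩ | ⟨rfl, rfl⟩ | ⟨rfl, rfl⟩ | ⟨rfl, rfl⟩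
  · exact eq_span_pair_of_unique_root_of_sq hθ h3 csDisc_twentythree_sq (by norm_num) hP hle
      (by decide) (by norm_num)
  · exact eq_span_pair_of_unique_root_of_sq hθ h3 csDisc_twentythree_sq (by norm_num) hP hle
      (by decide) (by norm_num)
  · exact eq_span_pair_of_unique_root_of_sq hθ h3 csDisc_twentythree_sq (by norm_num) hP hle
      (by decide) (by norm_num)
  · exact eq_span_pair_of_unique_root_of_sq hθ h3 csDisc_twentythree_sq (by norm_num) hP hle
      (by decide) (by norm_num)
  · exact eq_span_pair_of_unique_root_of_sq hθ h3 csDisc_twentythree_sq (by norm_num) hP hle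
      (by decide) (by norm_num)
  · exact eq_span_pair_of_unique_root_of_sq hθ h3 csDisc_twentythree_sq (by norm_num) hP hle
      (by decide) (by norm_num)
  · exact eq_span_pair_of_unique_root_of_sq hθ h3 csDisc_twentythree_sq (by norm_num) hP hle
      (by decide) (by norm_num)
  · exact eq_span_pair_of_unique_root_of_sq hθ h3 csDisc_twentythree_sq (by norm_num) hP hle
      (by decide) (by norm_num)
  · exact eq_span_pair_of_unique_root_of_sq hθ h3 csDisc_twentythree_sq (by norm_num) hP hle
      (by decide) (by norm_num)
  · exact eq_span_pair_of_unique_root_of_sq hθ h3 csDisc_twentythree_sq (by norm_num) hP hle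
      (by decide) (by norm_num)
  · exact eq_span_pair_of_unique_root_of_sq hθ h3 csDisc_twentythree_sq (by norm_num) hP hle
      (by decide) (by norm_num)
  · exact eq_span_pair_of_unique_root_of_sq hθ h3 csDisc_twentythree_sq (by norm_num) hP hle
      (by decide) (by norm_num)
  · exact eq_span_pair_of_unique_root_of_sq hθ h3 csDisc_twentythree_sq (by norm_num) hP hle
      (by decide) (by norm_num)

/-- `f₂₃ = (x - 3)(x^2 + 2) + 5(-4 * x^2 + 4 * x + 1)`: the factorisation modulo `5`. [folklore] -/
theorem csPoly_twentythree_eq_five :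
    csPoly 23 = (X - 3) * (X ^ 2 + 2) + 5 * (-4 * X ^ 2 + 4 * X + 1) := by
  simp only [csPoly, map_sub, map_one, map_ofNat]
  ring

set_option linter.unusedSimpArgs false in
/-- The lift `X ^ 2 + 2` reduces modulo `5` to the same expression in `𝔽₅[x]`. [folklore] -/
theorem map_quad_twentythree_five :
    (X ^ 2 + 2 : ℤ[X]).map (Int.castRingHom (ZMod 5)) = X ^ 2 + 2 := by
  simp only [Polynomial.map_add, Polynomial.map_sub, Polynomial.map_neg, Polynomial.map_mul, Polynomial.map_pow,
    map_X, Polynomial.map_ofNat, Polynomial.map_one]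

set_option linter.unusedSimpArgs false in
/-- `f₂₃ mod 5 = (x - 3)·(X ^ 2 + 2)`. [folklore] -/
theorem csPolyMod_twentythree_five :
    csPolyMod 23 5 = (X - C ((3 : ℤ) : ZMod 5)) *
      (X ^ 2 + 2 : ℤ[X]).map (Int.castRingHom (ZMod 5)) := by
  rw [csPolyMod, csPoly_twentythree_eq_five, Polynomial.map_add]
  have hp : Polynomial.map (Int.castRingHom (ZMod 5)) (5 * (-4 * X ^ 2 + 4 * X + 1) : ℤ[X]) = 0 := by
    rw [Polynomial.map_mul, show (5 : ℤ[X]) = C 5 from rfl, Polynomial.map_C]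
    have : (Int.castRingHom (ZMod 5)) 5 = 0 := by decide
    rw [this, C_0, zero_mul]
  rw [hp, add_zero, map_quad_twentythree_five]
  simp only [Polynomial.map_mul, Polynomial.map_sub, Polynomial.map_add, Polynomial.map_neg, Polynomial.map_pow,
    map_X, Polynomial.map_ofNat, Polynomial.map_one, Int.cast_ofNat, map_ofNat]

/-- `X ^ 2 + 2` is monic over `𝔽₅`. [folklore] -/
theorem monic_quad_twentythree_five :
    ((X ^ 2 + 2 : ℤ[X]).map (Int.castRingHom (ZMod 5))).Monic := by
  rw [map_quad_twentythree_five]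
  monicity!

/-- `X ^ 2 + 2` has no root modulo `5`. [folklore] -/
theorem quad_twentythree_five_ne_zero : ∀ c : ZMod 5, c ^ 2 + 2 ≠ 0 := by
  decide

/-- `X ^ 2 + 2` is irreducible over `𝔽₅`. [folklore] -/
theorem irreducible_quad_twentythree_five :
    Irreducible ((X ^ 2 + 2 : ℤ[X]).map (Int.castRingHom (ZMod 5))) := by
  haveI := Fact.mk (show Nat.Prime 5 by norm_num)
  rw [map_quad_twentythree_five]
  have hdeg : (X ^ 2 + 2 : (ZMod 5)[X]).natDegree = 2 := by compute_degree!
  refine irreducible_of_degree_le_three_of_not_isRoot (by rw [hdeg]; decide) fun c hc =>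
    quad_twentythree_five_ne_zero c ?_
  have h := hc
  rw [IsRoot.def] at h
  simpa using h

set_option linter.unusedSimpArgs false in
/-- **The primes above `5`**: `(5, θ - 3)` (degree one) and `(5, θ ^ 2 + 2)` (degree two). [folklore] -/
theorem eq_P5_or_eq_Q5_twentythree (hθ : aeval θ (csPoly 23) = 0) (h3 : finrank ℚ K = 3)
    {P : Ideal (𝓞 K)} (hP : P ∈ primesOver (span {((5 : ℕ) : ℤ)}) (𝓞 K)) :
    P = span {(5 : 𝓞 K), thetaInt hθ - 3} ∨
      P = span {(5 : 𝓞 K), thetaInt hθ ^ 2 + 2} := by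
  rcases eq_span_pair_of_linear_mul_quadratic_of_sq hθ h3 csDisc_twentythree_sq (by norm_num)
    monic_quad_twentythree_five irreducible_quad_twentythree_five csPolyMod_twentythree_five hP with h | h
  · left; simpa using h
  · right
    simp only [map_add, map_sub, map_neg, map_mul, map_pow, aeval_X, map_ofNat, map_one] at h
    simpa using h

/-- `f₂₃ = (x - 4)(x^2 + 2 * x + 2) + 7(-3 * x^2 + 4 * x + 1)`: the factorisation modulo `7`. [folklore] -/
theorem csPoly_twentythree_eq_seven :
    csPoly 23 = (X - 4) * (X ^ 2 + 2 * X + 2) + 7 * (-3 * X ^ 2 + 4 * X + 1) := by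
  simp only [csPoly, map_sub, map_one, map_ofNat]
  ring

set_option linter.unusedSimpArgs false in
/-- The lift `X ^ 2 + 2 * X + 2` reduces modulo `7` to the same expression in `𝔽₇[x]`. [folklore] -/
theorem map_quad_twentythree_seven :
    (X ^ 2 + 2 * X + 2 : ℤ[X]).map (Int.castRingHom (ZMod 7)) = X ^ 2 + 2 * X + 2 := by
  simp only [Polynomial.map_add, Polynomial.map_sub, Polynomial.map_neg, Polynomial.map_mul, Polynomial.map_pow,
    map_X, Polynomial.map_ofNat, Polynomial.map_one]

set_option linter.unusedSimpArgs false in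
/-- `f₂₃ mod 7 = (x - 4)·(X ^ 2 + 2 * X + 2)`. [folklore] -/
theorem csPolyMod_twentythree_seven :
    csPolyMod 23 7 = (X - C ((4 : ℤ) : ZMod 7)) *
      (X ^ 2 + 2 * X + 2 : ℤ[X]).map (Int.castRingHom (ZMod 7)) := by
  rw [csPolyMod, csPoly_twentythree_eq_seven, Polynomial.map_add]
  have hp : Polynomial.map (Int.castRingHom (ZMod 7)) (7 * (-3 * X ^ 2 + 4 * X + 1) : ℤ[X]) = 0 := by
    rw [Polynomial.map_mul, show (7 : ℤ[X]) = C 7 from rfl, Polynomial.map_C]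
    have : (Int.castRingHom (ZMod 7)) 7 = 0 := by decide
    rw [this, C_0, zero_mul]
  rw [hp, add_zero, map_quad_twentythree_seven]
  simp only [Polynomial.map_mul, Polynomial.map_sub, Polynomial.map_add, Polynomial.map_neg, Polynomial.map_pow,
    map_X, Polynomial.map_ofNat, Polynomial.map_one, Int.cast_ofNat, map_ofNat]

/-- `X ^ 2 + 2 * X + 2` is monic over `𝔽₇`. [folklore] -/
theorem monic_quad_twentythree_seven :
    ((X ^ 2 + 2 * X + 2 : ℤ[X]).map (Int.castRingHom (ZMod 7))).Monic := by
  rw [map_quad_twentythree_seven]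
  monicity!

/-- `X ^ 2 + 2 * X + 2` has no root modulo `7`. [folklore] -/
theorem quad_twentythree_seven_ne_zero : ∀ c : ZMod 7, c ^ 2 + 2 * c + 2 ≠ 0 := by
  decide

/-- `X ^ 2 + 2 * X + 2` is irreducible over `𝔽₇`. [folklore] -/
theorem irreducible_quad_twentythree_seven :
    Irreducible ((X ^ 2 + 2 * X + 2 : ℤ[X]).map (Int.castRingHom (ZMod 7))) := by
  haveI := Fact.mk (show Nat.Prime 7 by norm_num)
  rw [map_quad_twentythree_seven]
  have hdeg : (X ^ 2 + 2 * X + 2 : (ZMod 7)[X]).natDegree = 2 := by compute_degree!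
  refine irreducible_of_degree_le_three_of_not_isRoot (by rw [hdeg]; decide) fun c hc =>
    quad_twentythree_seven_ne_zero c ?_
  have h := hc
  rw [IsRoot.def] at h
  simpa using h

set_option linter.unusedSimpArgs false in
/-- **The primes above `7`**: `(7, θ - 4)` (degree one) and `(7, θ ^ 2 + 2 * θ + 2)` (degree two). [folklore] -/
theorem eq_P7_or_eq_Q7_twentythree (hθ : aeval θ (csPoly 23) = 0) (h3 : finrank ℚ K = 3)
    {P : Ideal (𝓞 K)} (hP : P ∈ primesOver (span {((7 : ℕ) : ℤ)}) (𝓞 K)) :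
    P = span {(7 : 𝓞 K), thetaInt hθ - 4} ∨
      P = span {(7 : 𝓞 K), thetaInt hθ ^ 2 + 2 * thetaInt hθ + 2} := by
  rcases eq_span_pair_of_linear_mul_quadratic_of_sq hθ h3 csDisc_twentythree_sq (by norm_num)
    monic_quad_twentythree_seven irreducible_quad_twentythree_seven csPolyMod_twentythree_seven hP with h | h
  · left; simpa using h
  · right
    simp only [map_add, map_sub, map_neg, map_mul, map_pow, aeval_X, map_ofNat, map_one] at h
    simpa using h

/-- `f₂₃ = (x - 3)(x - 10)(x - 10) + 23(-6 * x + 13)`: `f₂₃ ≡ (x - 3)(x - 10)(x - 10) (mod 23)`. [folklore] -/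
theorem csPoly_twentythree_eq_twentythree :
    csPoly 23 = (X - 3) * (X - 10) * (X - 10) + 23 * (-6 * X + 13) := by
  simp only [csPoly, map_sub, map_one, map_ofNat]
  ring

/-- `f₂₃ mod 23 = (x - 3)(x - 10)(x - 10)`. [folklore] -/
theorem csPolyMod_twentythree_twentythree :
    csPolyMod 23 23 = (X - C ((3 : ℤ) : ZMod 23)) * (X - C ((10 : ℤ) : ZMod 23)) *
      (X - C ((10 : ℤ) : ZMod 23)) := by
  rw [csPolyMod, csPoly_twentythree_eq_twentythree, Polynomial.map_add]
  have hp : Polynomial.map (Int.castRingHom (ZMod 23)) (23 * (-6 * X + 13) : ℤ[X]) = 0 := by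
    rw [Polynomial.map_mul, show (23 : ℤ[X]) = C 23 from rfl, Polynomial.map_C]
    have : (Int.castRingHom (ZMod 23)) 23 = 0 := by decide
    rw [this, C_0, zero_mul]
  rw [hp, add_zero]
  simp only [Polynomial.map_mul, Polynomial.map_sub, map_X, Polynomial.map_ofNat, Int.cast_ofNat,
    map_ofNat]

/-- **The primes above `23`**: `(23, θ - 3)`, `(23, θ - 10)`, `(23, θ - 10)`. [folklore] -/
theorem eq_P23_twentythree (hθ : aeval θ (csPoly 23) = 0) (h3 : finrank ℚ K = 3)
    {P : Ideal (𝓞 K)} (hP : P ∈ primesOver (span {((23 : ℕ) : ℤ)}) (𝓞 K)) :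
    P = span {(23 : 𝓞 K), thetaInt hθ - 3} ∨ P = span {(23 : 𝓞 K), thetaInt hθ - 10} ∨
      P = span {(23 : 𝓞 K), thetaInt hθ - 10} := by
  rcases eq_span_pair_of_split_of_sq hθ h3 csDisc_twentythree_sq (by norm_num)
    csPolyMod_twentythree_twentythree hP with h | h | h
  · left; simpa using h
  · right; left; simpa using h
  · right; right; simpa using h

/-- `f₂₃ = (x - 4)(x - 5)(x - 14) + 31(-4 * x + 9)`: `f₂₃ ≡ (x - 4)(x - 5)(x - 14) (mod 31)`. [folklore] -/
theorem csPoly_twentythree_eq_thirtyone :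
    csPoly 23 = (X - 4) * (X - 5) * (X - 14) + 31 * (-4 * X + 9) := by
  simp only [csPoly, map_sub, map_one, map_ofNat]
  ring

/-- `f₂₃ mod 31 = (x - 4)(x - 5)(x - 14)`. [folklore] -/
theorem csPolyMod_twentythree_thirtyone :
    csPolyMod 23 31 = (X - C ((4 : ℤ) : ZMod 31)) * (X - C ((5 : ℤ) : ZMod 31)) *
      (X - C ((14 : ℤ) : ZMod 31)) := by
  rw [csPolyMod, csPoly_twentythree_eq_thirtyone, Polynomial.map_add]
  have hp : Polynomial.map (Int.castRingHom (ZMod 31)) (31 * (-4 * X + 9) : ℤ[X]) = 0 := by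
    rw [Polynomial.map_mul, show (31 : ℤ[X]) = C 31 from rfl, Polynomial.map_C]
    have : (Int.castRingHom (ZMod 31)) 31 = 0 := by decide
    rw [this, C_0, zero_mul]
  rw [hp, add_zero]
  simp only [Polynomial.map_mul, Polynomial.map_sub, map_X, Polynomial.map_ofNat, Int.cast_ofNat,
    map_ofNat]

/-- **The primes above `31`**: `(31, θ - 4)`, `(31, θ - 5)`, `(31, θ - 14)`. [folklore] -/
theorem eq_P31_twentythree (hθ : aeval θ (csPoly 23) = 0) (h3 : finrank ℚ K = 3)
    {P : Ideal (𝓞 K)} (hP : P ∈ primesOver (span {((31 : ℕ) : ℤ)}) (𝓞 K)) :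
    P = span {(31 : 𝓞 K), thetaInt hθ - 4} ∨ P = span {(31 : 𝓞 K), thetaInt hθ - 5} ∨
      P = span {(31 : 𝓞 K), thetaInt hθ - 14} := by
  rcases eq_span_pair_of_split_of_sq hθ h3 csDisc_twentythree_sq (by norm_num)
    csPolyMod_twentythree_thirtyone hP with h | h | h
  · left; simpa using h
  · right; left; simpa using h
  · right; right; simpa using h

/-- `f₂₃ = (x - 10)(x - 14)(x - 46) + 47(x^2 - 26 * x + 137)`: `f₂₃ ≡ (x - 10)(x - 14)(x - 46) (mod 47)`. [folklore] -/
theorem csPoly_twentythree_eq_fortyseven :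
    csPoly 23 = (X - 10) * (X - 14) * (X - 46) + 47 * (X ^ 2 - 26 * X + 137) := by
  simp only [csPoly, map_sub, map_one, map_ofNat]
  ring

/-- `f₂₃ mod 47 = (x - 10)(x - 14)(x - 46)`. [folklore] -/
theorem csPolyMod_twentythree_fortyseven :
    csPolyMod 23 47 = (X - C ((10 : ℤ) : ZMod 47)) * (X - C ((14 : ℤ) : ZMod 47)) *
      (X - C ((46 : ℤ) : ZMod 47)) := by
  rw [csPolyMod, csPoly_twentythree_eq_fortyseven, Polynomial.map_add]
  have hp : Polynomial.map (Int.castRingHom (ZMod 47)) (47 * (X ^ 2 - 26 * X + 137) : ℤ[X]) = 0 := by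
    rw [Polynomial.map_mul, show (47 : ℤ[X]) = C 47 from rfl, Polynomial.map_C]
    have : (Int.castRingHom (ZMod 47)) 47 = 0 := by decide
    rw [this, C_0, zero_mul]
  rw [hp, add_zero]
  simp only [Polynomial.map_mul, Polynomial.map_sub, map_X, Polynomial.map_ofNat, Int.cast_ofNat,
    map_ofNat]

/-- **The primes above `47`**: `(47, θ - 10)`, `(47, θ - 14)`, `(47, θ - 46)`. [folklore] -/
theorem eq_P47_twentythree (hθ : aeval θ (csPoly 23) = 0) (h3 : finrank ℚ K = 3)
    {P : Ideal (𝓞 K)} (hP : P ∈ primesOver (span {((47 : ℕ) : ℤ)}) (𝓞 K)) :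
    P = span {(47 : 𝓞 K), thetaInt hθ - 10} ∨ P = span {(47 : 𝓞 K), thetaInt hθ - 14} ∨
      P = span {(47 : 𝓞 K), thetaInt hθ - 46} := by
  rcases eq_span_pair_of_split_of_sq hθ h3 csDisc_twentythree_sq (by norm_num)
    csPolyMod_twentythree_fortyseven hP with h | h | h
  · left; simpa using h
  · right; left; simpa using h
  · right; right; simpa using h

/-- `f₂₃ = (x - 23)(x - 33)(x - 68) + 101(x^2 - 45 * x + 511)`: `f₂₃ ≡ (x - 23)(x - 33)(x - 68) (mod 101)`. [folklore] -/
theorem csPoly_twentythree_eq_hundredone :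
    csPoly 23 = (X - 23) * (X - 33) * (X - 68) + 101 * (X ^ 2 - 45 * X + 511) := by
  simp only [csPoly, map_sub, map_one, map_ofNat]
  ring

/-- `f₂₃ mod 101 = (x - 23)(x - 33)(x - 68)`. [folklore] -/
theorem csPolyMod_twentythree_hundredone :
    csPolyMod 23 101 = (X - C ((23 : ℤ) : ZMod 101)) * (X - C ((33 : ℤ) : ZMod 101)) *
      (X - C ((68 : ℤ) : ZMod 101)) := by
  rw [csPolyMod, csPoly_twentythree_eq_hundredone, Polynomial.map_add]
  have hp : Polynomial.map (Int.castRingHom (ZMod 101)) (101 * (X ^ 2 - 45 * X + 511) : ℤ[X]) = 0 := by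
    rw [Polynomial.map_mul, show (101 : ℤ[X]) = C 101 from rfl, Polynomial.map_C]
    have : (Int.castRingHom (ZMod 101)) 101 = 0 := by decide
    rw [this, C_0, zero_mul]
  rw [hp, add_zero]
  simp only [Polynomial.map_mul, Polynomial.map_sub, map_X, Polynomial.map_ofNat, Int.cast_ofNat,
    map_ofNat]

/-- **The primes above `101`**: `(101, θ - 23)`, `(101, θ - 33)`, `(101, θ - 68)`. [folklore] -/
theorem eq_P101_twentythree (hθ : aeval θ (csPoly 23) = 0) (h3 : finrank ℚ K = 3)
    {P : Ideal (𝓞 K)} (hP : P ∈ primesOver (span {((101 : ℕ) : ℤ)}) (𝓞 K)) :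
    P = span {(101 : 𝓞 K), thetaInt hθ - 23} ∨ P = span {(101 : 𝓞 K), thetaInt hθ - 33} ∨
      P = span {(101 : 𝓞 K), thetaInt hθ - 68} := by
  rcases eq_span_pair_of_split_of_sq hθ h3 csDisc_twentythree_sq (by norm_num)
    csPolyMod_twentythree_hundredone hP with h | h | h
  · left; simpa using h
  · right; left; simpa using h
  · right; right; simpa using h

/-- `f₂₃ = (x - 44)(x - 92)(x - 101) + 107(2 * x^2 - 166 * x + 3821)`: `f₂₃ ≡ (x - 44)(x - 92)(x - 101) (mod 107)`. [folklore] -/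
theorem csPoly_twentythree_eq_hundredseven :
    csPoly 23 = (X - 44) * (X - 92) * (X - 101) + 107 * (2 * X ^ 2 - 166 * X + 3821) := by
  simp only [csPoly, map_sub, map_one, map_ofNat]
  ring

/-- `f₂₃ mod 107 = (x - 44)(x - 92)(x - 101)`. [folklore] -/
theorem csPolyMod_twentythree_hundredseven :
    csPolyMod 23 107 = (X - C ((44 : ℤ) : ZMod 107)) * (X - C ((92 : ℤ) : ZMod 107)) *
      (X - C ((101 : ℤ) : ZMod 107)) := by
  rw [csPolyMod, csPoly_twentythree_eq_hundredseven, Polynomial.map_add]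
  have hp : Polynomial.map (Int.castRingHom (ZMod 107)) (107 * (2 * X ^ 2 - 166 * X + 3821) : ℤ[X]) = 0 := by
    rw [Polynomial.map_mul, show (107 : ℤ[X]) = C 107 from rfl, Polynomial.map_C]
    have : (Int.castRingHom (ZMod 107)) 107 = 0 := by decide
    rw [this, C_0, zero_mul]
  rw [hp, add_zero]
  simp only [Polynomial.map_mul, Polynomial.map_sub, map_X, Polynomial.map_ofNat, Int.cast_ofNat,
    map_ofNat]

/-- **The primes above `107`**: `(107, θ - 44)`, `(107, θ - 92)`, `(107, θ - 101)`. [folklore] -/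
theorem eq_P107_twentythree (hθ : aeval θ (csPoly 23) = 0) (h3 : finrank ℚ K = 3)
    {P : Ideal (𝓞 K)} (hP : P ∈ primesOver (span {((107 : ℕ) : ℤ)}) (𝓞 K)) :
    P = span {(107 : 𝓞 K), thetaInt hθ - 44} ∨ P = span {(107 : 𝓞 K), thetaInt hθ - 92} ∨
      P = span {(107 : 𝓞 K), thetaInt hθ - 101} := by
  rcases eq_span_pair_of_split_of_sq hθ h3 csDisc_twentythree_sq (by norm_num)
    csPolyMod_twentythree_hundredseven hP with h | h | h
  · left; simpa using h
  · right; left; simpa using h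
  · right; right; simpa using h

/-- `f₂₃ = (x - 26)(x - 45)(x - 65) + 113(x^2 - 51 * x + 673)`: `f₂₃ ≡ (x - 26)(x - 45)(x - 65) (mod 113)`. [folklore] -/
theorem csPoly_twentythree_eq_hundredthirteen :
    csPoly 23 = (X - 26) * (X - 45) * (X - 65) + 113 * (X ^ 2 - 51 * X + 673) := by
  simp only [csPoly, map_sub, map_one, map_ofNat]
  ring

/-- `f₂₃ mod 113 = (x - 26)(x - 45)(x - 65)`. [folklore] -/
theorem csPolyMod_twentythree_hundredthirteen :
    csPolyMod 23 113 = (X - C ((26 : ℤ) : ZMod 113)) * (X - C ((45 : ℤ) : ZMod 113)) *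
      (X - C ((65 : ℤ) : ZMod 113)) := by
  rw [csPolyMod, csPoly_twentythree_eq_hundredthirteen, Polynomial.map_add]
  have hp : Polynomial.map (Int.castRingHom (ZMod 113)) (113 * (X ^ 2 - 51 * X + 673) : ℤ[X]) = 0 := by
    rw [Polynomial.map_mul, show (113 : ℤ[X]) = C 113 from rfl, Polynomial.map_C]
    have : (Int.castRingHom (ZMod 113)) 113 = 0 := by decide
    rw [this, C_0, zero_mul]
  rw [hp, add_zero]
  simp only [Polynomial.map_mul, Polynomial.map_sub, map_X, Polynomial.map_ofNat, Int.cast_ofNat,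
    map_ofNat]

/-- **The primes above `113`**: `(113, θ - 26)`, `(113, θ - 45)`, `(113, θ - 65)`. [folklore] -/
theorem eq_P113_twentythree (hθ : aeval θ (csPoly 23) = 0) (h3 : finrank ℚ K = 3)
    {P : Ideal (𝓞 K)} (hP : P ∈ primesOver (span {((113 : ℕ) : ℤ)}) (𝓞 K)) :
    P = span {(113 : 𝓞 K), thetaInt hθ - 26} ∨ P = span {(113 : 𝓞 K), thetaInt hθ - 45} ∨
      P = span {(113 : 𝓞 K), thetaInt hθ - 65} := by
  rcases eq_span_pair_of_split_of_sq hθ h3 csDisc_twentythree_sq (by norm_num)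
    csPolyMod_twentythree_hundredthirteen hP with h | h | h
  · left; simpa using h
  · right; left; simpa using h
  · right; right; simpa using h

/-! ### Relations among the small primes: explicit generators -/

/-- **`𝔭₅² = (25, θ - 18)`** (`18 ≡ 3 (mod 5)` is the root of `f₂₃` modulo `25`). [folklore] -/
theorem P5_mul_P5_twentythree (hθ : aeval θ (csPoly 23) = 0) :
    span {(5 : 𝓞 K), thetaInt hθ - 3} * span {(5 : 𝓞 K), thetaInt hθ - 3} =
      span {(25 : 𝓞 K), thetaInt hθ - 18} := by
  have rel := thetaInt_rel_twentythree hθ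
  set t := thetaInt hθ with ht
  exact span_pair_mul_span_pair_eq_span_pair
    (α₁ := 1) (β₁ := 0)
    (α₂ := 3) (β₂ := 5)
    (α₃ := 3) (β₃ := 5)
    (α₄ := -524 * t ^ 2) (β₄ := 3465 * t ^ 2 - 4224 * t + 192)
    (u₁ := 1) (u₂ := 0) (u₃ := 0) (u₄ := 0)
    (v₁ := -2849 * t ^ 2) (v₂ := -4660 * t + 233) (v₃ := 0) (v₄ := 5574 * t - 233)
    (by ring) (by ring) (by ring) (by linear_combination (-3465 : 𝓞 K) * rel)
    (by ring) (by linear_combination (-5574 : 𝓞 K) * rel)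

/-- **`(25, θ - 18) 𝔭₁₁ = (3θ - 4)`** (`N = 275`): `[𝔭₁₁] = [𝔭₅]⁻²`. [folklore] -/
theorem P25_mul_P11_twentythree (hθ : aeval θ (csPoly 23) = 0) :
    span {(25 : 𝓞 K), thetaInt hθ - 18} * span {(11 : 𝓞 K), thetaInt hθ - 5} =
      span {3 * thetaInt hθ - 4} := by
  have rel := thetaInt_rel_twentythree hθ
  set t := thetaInt hθ with ht
  exact span_pair_mul_span_pair_eq_span_singleton
    (δ₁ := 9 * t ^ 2 - 195 * t - 62) (δ₂ := -3 * t ^ 2 + 65 * t + 29)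
    (δ₃ := -6 * t ^ 2 + 130 * t + 45) (δ₄ := 2 * t ^ 2 - 43 * t - 21)
    (u₁ := -1) (u₂ := 1) (u₃ := -2) (u₄ := 0)
    (by linear_combination (-27 : 𝓞 K) * rel) (by linear_combination (9 : 𝓞 K) * rel)
    (by linear_combination (18 : 𝓞 K) * rel) (by linear_combination (-6 : 𝓞 K) * rel)
    (by ring)

/-- **`𝔭₁₁ 𝔭₁₃ = (2θ + 1)`** (`N = 143`): `[𝔭₁₃] = [𝔭₅]²`. [folklore] -/
theorem P11_mul_P13_twentythree (hθ : aeval θ (csPoly 23) = 0) :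
    span {(11 : 𝓞 K), thetaInt hθ - 5} * span {(13 : 𝓞 K), thetaInt hθ - 6} =
      span {2 * thetaInt hθ + 1} := by
  have rel := thetaInt_rel_twentythree hθ
  set t := thetaInt hθ with ht
  exact span_pair_mul_span_pair_eq_span_singleton
    (δ₁ := 4 * t ^ 2 - 94 * t + 135) (δ₂ := -2 * t ^ 2 + 47 * t - 62)
    (δ₃ := -2 * t ^ 2 + 47 * t - 61) (δ₄ := t ^ 2 - 23 * t + 28)
    (u₁ := 0) (u₂ := -1) (u₃ := 1) (u₄ := 0)
    (by linear_combination (-8 : 𝓞 K) * rel) (by linear_combination (4 : 𝓞 K) * rel)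
    (by linear_combination (4 : 𝓞 K) * rel) (by linear_combination (-2 : 𝓞 K) * rel)
    (by ring)

/-- **`𝔭₁₃² = (169, θ - 71)`** (`71 ≡ 6 (mod 13)` is the root of `f₂₃` modulo `169`). [folklore] -/
theorem P13_mul_P13_twentythree (hθ : aeval θ (csPoly 23) = 0) :
    span {(13 : 𝓞 K), thetaInt hθ - 6} * span {(13 : 𝓞 K), thetaInt hθ - 6} =
      span {(169 : 𝓞 K), thetaInt hθ - 71} := by
  have rel := thetaInt_rel_twentythree hθ
  set t := thetaInt hθ with ht
  exact span_pair_mul_span_pair_eq_span_pair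
    (α₁ := 1) (β₁ := 0)
    (α₂ := 5) (β₂ := 13)
    (α₃ := 5) (β₃ := 13)
    (α₄ := 15841 * t ^ 2) (β₄ := 55416 * t ^ 2 - 17160 * t + 780)
    (u₁ := 1) (u₂ := 0) (u₃ := 0) (u₄ := 0)
    (v₁ := -51441 * t ^ 2) (v₂ := 118405 * t + 6965) (v₃ := 0) (v₄ := 650659 * t - 2985)
    (by ring) (by ring) (by ring) (by linear_combination (-55416 : 𝓞 K) * rel)
    (by ring) (by linear_combination (-650659 : 𝓞 K) * rel)

/-- **`𝔭₅ (169, θ - 71) = (θ² - 2θ + 2)`** (`N = 845 = 5·13²`): with the above, `[𝔭₅]⁵ = 1`. [folklore] -/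
theorem P5_mul_P169_twentythree (hθ : aeval θ (csPoly 23) = 0) :
    span {(5 : 𝓞 K), thetaInt hθ - 3} * span {(169 : 𝓞 K), thetaInt hθ - 71} =
      span {thetaInt hθ ^ 2 - 2 * thetaInt hθ + 2} := by
  have rel := thetaInt_rel_twentythree hθ
  set t := thetaInt hθ with ht
  exact span_pair_mul_span_pair_eq_span_singleton
    (δ₁ := -22 * t ^ 2 + 465 * t + 421) (δ₂ := 9 * t ^ 2 - 190 * t - 177)
    (δ₃ := 5 * t ^ 2 - 98 * t - 257) (δ₄ := -2 * t ^ 2 + 39 * t + 108)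
    (u₁ := 33) (u₂ := 82) (u₃ := -2) (u₄ := 1)
    (by linear_combination (22 * t - 3) * rel) (by linear_combination (-9 * t + 1) * rel)
    (by linear_combination (-5 * t - 7) * rel) (by linear_combination (2 * t + 3) * rel)
    (by ring)

/-- **`𝔭₅ 𝔭₇ = (2θ - 1)`** (`N = -35`). [folklore] -/
theorem P5_mul_P7_twentythree (hθ : aeval θ (csPoly 23) = 0) :
    span {(5 : 𝓞 K), thetaInt hθ - 3} * span {(7 : 𝓞 K), thetaInt hθ - 4} =
      span {2 * thetaInt hθ - 1} := by
  have rel := thetaInt_rel_twentythree hθ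
  set t := thetaInt hθ with ht
  exact span_pair_mul_span_pair_eq_span_singleton
    (δ₁ := -4 * t ^ 2 + 90 * t - 43) (δ₂ := 2 * t ^ 2 - 45 * t + 24)
    (δ₃ := 2 * t ^ 2 - 45 * t + 25) (δ₄ := -t ^ 2 + 23 * t - 14)
    (u₁ := 0) (u₂ := -1) (u₃ := 1) (u₄ := 0)
    (by linear_combination (8 : 𝓞 K) * rel) (by linear_combination (-4 : 𝓞 K) * rel)
    (by linear_combination (-4 : 𝓞 K) * rel) (by linear_combination (2 : 𝓞 K) * rel)
    (by ring)

/-- **`𝔭₅ 𝔮₂₅ = (5)`**, `𝔮₂₅ = (5, θ² + 2)` (`f₂₃ ≡ (x - 3)(x² + 2) (mod 5)`). [folklore] -/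
theorem P5_mul_Q5_twentythree (hθ : aeval θ (csPoly 23) = 0) :
    span {(5 : 𝓞 K), thetaInt hθ - 3} * span {(5 : 𝓞 K), thetaInt hθ ^ 2 + 2} =
      span {5} := by
  have rel := thetaInt_rel_twentythree hθ
  set t := thetaInt hθ with ht
  exact span_pair_mul_span_pair_eq_span_singleton
    (δ₁ := 5) (δ₂ := t ^ 2 + 2)
    (δ₃ := t - 3) (δ₄ := 4 * t ^ 2 - 4 * t - 1)
    (u₁ := -4) (u₂ := 4) (u₃ := -4) (u₄ := -1)
    (by ring) (by ring)
    (by ring) (by linear_combination (1 : 𝓞 K) * rel)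
    (by linear_combination (1 : 𝓞 K) * rel)

/-- **`𝔭₇ 𝔮₄₉ = (7)`**, `𝔮₄₉ = (7, θ² + 2θ + 2)` (`f₂₃ ≡ (x - 4)(x² + 2x + 2) (mod 7)`). [folklore] -/
theorem P7_mul_Q7_twentythree (hθ : aeval θ (csPoly 23) = 0) :
    span {(7 : 𝓞 K), thetaInt hθ - 4} * span {(7 : 𝓞 K), thetaInt hθ ^ 2 + 2 * thetaInt hθ + 2} =
      span {7} := by
  have rel := thetaInt_rel_twentythree hθ
  set t := thetaInt hθ with ht
  exact span_pair_mul_span_pair_eq_span_singleton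
    (δ₁ := 7) (δ₂ := t ^ 2 + 2 * t + 2)
    (δ₃ := t - 4) (δ₄ := 3 * t ^ 2 - 4 * t - 1)
    (u₁ := -20) (u₂ := 9) (u₃ := -30) (u₄ := -3)
    (by ring) (by ring)
    (by ring) (by linear_combination (1 : 𝓞 K) * rel)
    (by linear_combination (3 : 𝓞 K) * rel)

/-- **`𝔭₅ (23, θ - 3) = (θ - 3)`** (`N = -115`; `23 ∣ Δ` ramifies, `f₂₃ ≡ (x - 3)(x - 10)² (mod 23)`). [folklore] -/
theorem P5_mul_P23a_twentythree (hθ : aeval θ (csPoly 23) = 0) :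
    span {(5 : 𝓞 K), thetaInt hθ - 3} * span {(23 : 𝓞 K), thetaInt hθ - 3} =
      span {thetaInt hθ - 3} := by
  have rel := thetaInt_rel_twentythree hθ
  set t := thetaInt hθ with ht
  exact span_pair_mul_span_pair_eq_span_singleton
    (δ₁ := t ^ 2 - 20 * t - 38) (δ₂ := 5)
    (δ₃ := 23) (δ₄ := t - 3)
    (u₁ := 0) (u₂ := -9) (u₃ := 2) (u₄ := 0)
    (by linear_combination (-1 : 𝓞 K) * rel) (by ring)
    (by ring) (by ring)
    (by ring)

/-- **`(23, θ - 10)(47, θ - 10) = (θ - 10)`** (`N = -1081 = -23·47`). [folklore] -/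
theorem P23b_mul_P47a_twentythree (hθ : aeval θ (csPoly 23) = 0) :
    span {(23 : 𝓞 K), thetaInt hθ - 10} * span {(47 : 𝓞 K), thetaInt hθ - 10} =
      span {thetaInt hθ - 10} := by
  have rel := thetaInt_rel_twentythree hθ
  set t := thetaInt hθ with ht
  exact span_pair_mul_span_pair_eq_span_singleton
    (δ₁ := t ^ 2 - 13 * t - 108) (δ₂ := 23)
    (δ₃ := 47) (δ₄ := t - 10)
    (u₁ := 0) (u₂ := -2) (u₃ := 1) (u₄ := 0)
    (by linear_combination (-1 : 𝓞 K) * rel) (by ring)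
    (by ring) (by ring)
    (by ring)

/-- **`𝔭₁₁ (47, θ - 10) = (5θ - 3)`** (`N = -517`). [folklore] -/
theorem P11_mul_P47a_twentythree (hθ : aeval θ (csPoly 23) = 0) :
    span {(11 : 𝓞 K), thetaInt hθ - 5} * span {(47 : 𝓞 K), thetaInt hθ - 10} =
      span {5 * thetaInt hθ - 3} := by
  have rel := thetaInt_rel_twentythree hθ
  set t := thetaInt hθ with ht
  exact span_pair_mul_span_pair_eq_span_singleton
    (δ₁ := -25 * t ^ 2 + 560 * t - 214) (δ₂ := 5 * t ^ 2 - 112 * t + 45)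
    (δ₃ := 10 * t ^ 2 - 224 * t + 95) (δ₄ := -2 * t ^ 2 + 45 * t - 20)
    (u₁ := 1) (u₂ := 9) (u₃ := -2) (u₄ := 0)
    (by linear_combination (125 : 𝓞 K) * rel) (by linear_combination (-25 : 𝓞 K) * rel)
    (by linear_combination (-50 : 𝓞 K) * rel) (by linear_combination (10 : 𝓞 K) * rel)
    (by ring)

/-- **`𝔭₅ 𝔭₂₉ = (θ + 2)`** (`N = 145`). [folklore] -/
theorem P5_mul_P29_twentythree (hθ : aeval θ (csPoly 23) = 0) :
    span {(5 : 𝓞 K), thetaInt hθ - 3} * span {(29 : 𝓞 K), thetaInt hθ - 27} =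
      span {thetaInt hθ + 2} := by
  have rel := thetaInt_rel_twentythree hθ
  set t := thetaInt hθ with ht
  exact span_pair_mul_span_pair_eq_span_singleton
    (δ₁ := t ^ 2 - 25 * t + 72) (δ₂ := -t ^ 2 + 25 * t - 67)
    (δ₃ := -t ^ 2 + 25 * t - 43) (δ₄ := t ^ 2 - 24 * t + 40)
    (u₁ := 5) (u₂ := 6) (u₃ := -1) (u₄ := 0)
    (by linear_combination (-1 : 𝓞 K) * rel) (by linear_combination (1 : 𝓞 K) * rel)
    (by linear_combination (1 : 𝓞 K) * rel) (by linear_combination (-1 : 𝓞 K) * rel)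
    (by ring)

/-- **`𝔭₇ (31, θ - 4) = (θ - 4)`** (`N = 217`). [folklore] -/
theorem P7_mul_P31a_twentythree (hθ : aeval θ (csPoly 23) = 0) :
    span {(7 : 𝓞 K), thetaInt hθ - 4} * span {(31 : 𝓞 K), thetaInt hθ - 4} =
      span {thetaInt hθ - 4} := by
  have rel := thetaInt_rel_twentythree hθ
  set t := thetaInt hθ with ht
  exact span_pair_mul_span_pair_eq_span_singleton
    (δ₁ := t ^ 2 - 19 * t - 54) (δ₂ := 7)
    (δ₃ := 31) (δ₄ := t - 4)
    (u₁ := 0) (u₂ := 9) (u₃ := -2) (u₄ := 0)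
    (by linear_combination (-1 : 𝓞 K) * rel) (by ring)
    (by ring) (by ring)
    (by ring)

/-- **`𝔭₁₁ (31, θ - 5) = (θ - 5)`** (`N = 341`). [folklore] -/
theorem P11_mul_P31b_twentythree (hθ : aeval θ (csPoly 23) = 0) :
    span {(11 : 𝓞 K), thetaInt hθ - 5} * span {(31 : 𝓞 K), thetaInt hθ - 5} =
      span {thetaInt hθ - 5} := by
  have rel := thetaInt_rel_twentythree hθ
  set t := thetaInt hθ with ht
  exact span_pair_mul_span_pair_eq_span_singleton
    (δ₁ := t ^ 2 - 18 * t - 68) (δ₂ := 11)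
    (δ₃ := 31) (δ₄ := t - 5)
    (u₁ := 0) (u₂ := -14) (u₃ := 5) (u₄ := 0)
    (by linear_combination (-1 : 𝓞 K) * rel) (by ring)
    (by ring) (by ring)
    (by ring)

/-- **`𝔭₁₁ (31, θ - 14) = (θ² - 3θ + 1)`** (`N = -341`). [folklore] -/
theorem P11_mul_P31c_twentythree (hθ : aeval θ (csPoly 23) = 0) :
    span {(11 : 𝓞 K), thetaInt hθ - 5} * span {(31 : 𝓞 K), thetaInt hθ - 14} =
      span {thetaInt hθ ^ 2 - 3 * thetaInt hθ + 1} := by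
  have rel := thetaInt_rel_twentythree hθ
  set t := thetaInt hθ with ht
  exact span_pair_mul_span_pair_eq_span_singleton
    (δ₁ := 39 * t ^ 2 - 878 * t + 439) (δ₂ := -17 * t ^ 2 + 383 * t - 197)
    (δ₃ := -16 * t ^ 2 + 361 * t - 196) (δ₄ := 7 * t ^ 2 - 158 * t + 88)
    (u₁ := -2) (u₂ := -7) (u₃ := 3) (u₄ := 1)
    (by linear_combination (-39 * t + 98) * rel) (by linear_combination (17 * t - 43) * rel)
    (by linear_combination (16 * t - 41) * rel) (by linear_combination (-7 * t + 18) * rel)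
    (by ring)

/-- **`𝔭₁₃ 𝔭₃₇ = (θ - 6)`** (`N = 481`). [folklore] -/
theorem P13_mul_P37_twentythree (hθ : aeval θ (csPoly 23) = 0) :
    span {(13 : 𝓞 K), thetaInt hθ - 6} * span {(37 : 𝓞 K), thetaInt hθ - 6} =
      span {thetaInt hθ - 6} := by
  have rel := thetaInt_rel_twentythree hθ
  set t := thetaInt hθ with ht
  exact span_pair_mul_span_pair_eq_span_singleton
    (δ₁ := t ^ 2 - 17 * t - 80) (δ₂ := 13)
    (δ₃ := 37) (δ₄ := t - 6)
    (u₁ := 0) (u₂ := -17) (u₃ := 6) (u₄ := 0)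
    (by linear_combination (-1 : 𝓞 K) * rel) (by ring)
    (by ring) (by ring)
    (by ring)

/-- **`𝔭₄₁ = (41, θ - 2) = (θ - 2)` is principal** (`N(θ - 2) = 41`). [folklore] -/
theorem P41_eq_twentythree (hθ : aeval θ (csPoly 23) = 0) :
    span {(41 : 𝓞 K), thetaInt hθ - 2} = span {thetaInt hθ - 2} := by
  have rel := thetaInt_rel_twentythree hθ
  set t := thetaInt hθ with ht
  exact span_pair_eq_span_singleton (u := 0) (v := 1) (δ := t ^ 2 - 21 * t - 20)
    (ε := 1)
    (by ring) (by linear_combination (-1 : 𝓞 K) * rel) (by ring)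

/-- **`𝔭₇ 𝔭₄₃ = (θ + 3)`** (`N = 301`). [folklore] -/
theorem P7_mul_P43_twentythree (hθ : aeval θ (csPoly 23) = 0) :
    span {(7 : 𝓞 K), thetaInt hθ - 4} * span {(43 : 𝓞 K), thetaInt hθ - 40} =
      span {thetaInt hθ + 3} := by
  have rel := thetaInt_rel_twentythree hθ
  set t := thetaInt hθ with ht
  exact span_pair_mul_span_pair_eq_span_singleton
    (δ₁ := t ^ 2 - 26 * t + 100) (δ₂ := -t ^ 2 + 26 * t - 93)
    (δ₃ := -t ^ 2 + 26 * t - 57) (δ₄ := t ^ 2 - 25 * t + 53)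
    (u₁ := -5) (u₂ := -6) (u₃ := 1) (u₄ := 0)
    (by linear_combination (-1 : 𝓞 K) * rel) (by linear_combination (1 : 𝓞 K) * rel)
    (by linear_combination (1 : 𝓞 K) * rel) (by linear_combination (-1 : 𝓞 K) * rel)
    (by ring)

/-- **`𝔭₁₃ (47, θ - 14) = (θ² - 4θ + 1)`** (`N = -611`). [folklore] -/
theorem P13_mul_P47b_twentythree (hθ : aeval θ (csPoly 23) = 0) :
    span {(13 : 𝓞 K), thetaInt hθ - 6} * span {(47 : 𝓞 K), thetaInt hθ - 14} =
      span {thetaInt hθ ^ 2 - 4 * thetaInt hθ + 1} := by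
  have rel := thetaInt_rel_twentythree hθ
  set t := thetaInt hθ with ht
  exact span_pair_mul_span_pair_eq_span_singleton
    (δ₁ := 55 * t ^ 2 - 1247 * t + 813) (δ₂ := -16 * t ^ 2 + 363 * t - 241)
    (δ₃ := -24 * t ^ 2 + 545 * t - 371) (δ₄ := 7 * t ^ 2 - 159 * t + 110)
    (u₁ := -1) (u₂ := -6) (u₃ := 2) (u₄ := 1)
    (by linear_combination (-55 * t + 202) * rel) (by linear_combination (16 * t - 59) * rel)
    (by linear_combination (24 * t - 89) * rel) (by linear_combination (-7 * t + 26) * rel)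
    (by ring)

/-- **`(47, θ - 46) = (θ + 1)` is principal** (`N(θ + 1) = 47`). [folklore] -/
theorem P47c_eq_twentythree (hθ : aeval θ (csPoly 23) = 0) :
    span {(47 : 𝓞 K), thetaInt hθ - 46} = span {thetaInt hθ + 1} := by
  have rel := thetaInt_rel_twentythree hθ
  set t := thetaInt hθ with ht
  exact span_pair_eq_span_singleton (u := 1) (v := 1) (δ := t ^ 2 - 24 * t + 46)
    (ε := -t ^ 2 + 24 * t - 45)
    (by ring) (by linear_combination (-1 : 𝓞 K) * rel) (by linear_combination (1 : 𝓞 K) * rel)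

/-- **`𝔭₅ 𝔭₅₉ = (3θ + 1)`** (`N = 295`). [folklore] -/
theorem P5_mul_P59_twentythree (hθ : aeval θ (csPoly 23) = 0) :
    span {(5 : 𝓞 K), thetaInt hθ - 3} * span {(59 : 𝓞 K), thetaInt hθ - 39} =
      span {3 * thetaInt hθ + 1} := by
  have rel := thetaInt_rel_twentythree hθ
  set t := thetaInt hθ with ht
  exact span_pair_mul_span_pair_eq_span_singleton
    (δ₁ := 9 * t ^ 2 - 210 * t + 268) (δ₂ := -6 * t ^ 2 + 140 * t - 177)
    (δ₃ := -6 * t ^ 2 + 140 * t - 159) (δ₄ := 4 * t ^ 2 - 93 * t + 105)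
    (u₁ := -14) (u₂ := -23) (u₃ := 2) (u₄ := 0)
    (by linear_combination (-27 : 𝓞 K) * rel) (by linear_combination (18 : 𝓞 K) * rel)
    (by linear_combination (18 : 𝓞 K) * rel) (by linear_combination (-12 : 𝓞 K) * rel)
    (by ring)

/-- **`𝔭₁₁ 𝔭₆₁ = (8θ - 7)`** (`N = -671`). [folklore] -/
theorem P11_mul_P61_twentythree (hθ : aeval θ (csPoly 23) = 0) :
    span {(11 : 𝓞 K), thetaInt hθ - 5} * span {(61 : 𝓞 K), thetaInt hθ - 39} =
      span {8 * thetaInt hθ - 7} := by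
  have rel := thetaInt_rel_twentythree hθ
  set t := thetaInt hθ with ht
  exact span_pair_mul_span_pair_eq_span_singleton
    (δ₁ := -64 * t ^ 2 + 1416 * t - 169) (δ₂ := 40 * t ^ 2 - 885 * t + 107)
    (δ₃ := 24 * t ^ 2 - 531 * t + 71) (δ₄ := -15 * t ^ 2 + 332 * t - 45)
    (u₁ := -15) (u₂ := -27) (u₃ := 5) (u₄ := 0)
    (by linear_combination (512 : 𝓞 K) * rel) (by linear_combination (-320 : 𝓞 K) * rel)
    (by linear_combination (-192 : 𝓞 K) * rel) (by linear_combination (120 : 𝓞 K) * rel)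
    (by ring)

/-- **`𝔭₁₁ 𝔭₇₃ = (θ² + 2θ - 2)`** (`N = -803`). [folklore] -/
theorem P11_mul_P73_twentythree (hθ : aeval θ (csPoly 23) = 0) :
    span {(11 : 𝓞 K), thetaInt hθ - 5} * span {(73 : 𝓞 K), thetaInt hθ - 51} =
      span {thetaInt hθ ^ 2 + 2 * thetaInt hθ - 2} := by
  have rel := thetaInt_rel_twentythree hθ
  set t := thetaInt hθ with ht
  exact span_pair_mul_span_pair_eq_span_singleton
    (δ₁ := -74 * t ^ 2 + 1651 * t - 501) (δ₂ := 51 * t ^ 2 - 1138 * t + 349)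
    (δ₃ := 29 * t ^ 2 - 648 * t + 221) (δ₄ := -20 * t ^ 2 + 447 * t - 154)
    (u₁ := -5) (u₂ := -8) (u₃ := 2) (u₄ := 1)
    (by linear_combination (74 * t + 199) * rel) (by linear_combination (-51 * t - 137) * rel)
    (by linear_combination (-29 * t - 77) * rel) (by linear_combination (20 * t + 53) * rel)
    (by ring)

/-- **`𝔭₁₃ 𝔭₇₉ = (θ - 19)`** (`N = 1027`). [folklore] -/
theorem P13_mul_P79_twentythree (hθ : aeval θ (csPoly 23) = 0) :
    span {(13 : 𝓞 K), thetaInt hθ - 6} * span {(79 : 𝓞 K), thetaInt hθ - 19} =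
      span {thetaInt hθ - 19} := by
  have rel := thetaInt_rel_twentythree hθ
  set t := thetaInt hθ with ht
  exact span_pair_mul_span_pair_eq_span_singleton
    (δ₁ := t ^ 2 - 4 * t - 54) (δ₂ := 13)
    (δ₃ := t ^ 2 - 4 * t + 25) (δ₄ := t - 6)
    (u₁ := -1) (u₂ := -6) (u₃ := 1) (u₄ := 0)
    (by linear_combination (-1 : 𝓞 K) * rel) (by ring)
    (by linear_combination (-1 : 𝓞 K) * rel) (by ring)
    (by ring)

/-- **`𝔭₁₃ 𝔭₈₃ = (11θ - 1)`** (`N = -1079`). [folklore] -/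
theorem P13_mul_P83_twentythree (hθ : aeval θ (csPoly 23) = 0) :
    span {(13 : 𝓞 K), thetaInt hθ - 6} * span {(83 : 𝓞 K), thetaInt hθ - 68} =
      span {11 * thetaInt hθ - 1} := by
  have rel := thetaInt_rel_twentythree hθ
  set t := thetaInt hθ with ht
  exact span_pair_mul_span_pair_eq_span_singleton
    (δ₁ := -121 * t ^ 2 + 2772 * t - 2410) (δ₂ := 99 * t ^ 2 - 2268 * t + 1973)
    (δ₃ := 55 * t ^ 2 - 1260 * t + 1103) (δ₄ := -45 * t ^ 2 + 1031 * t - 903)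
    (u₁ := 15) (u₂ := 20) (u₃ := -3) (u₄ := 0)
    (by linear_combination (1331 : 𝓞 K) * rel) (by linear_combination (-1089 : 𝓞 K) * rel)
    (by linear_combination (-605 : 𝓞 K) * rel) (by linear_combination (495 : 𝓞 K) * rel)
    (by ring)

/-- **`𝔭₅ (101, θ - 23) = (θ² - θ - 1)`** (`N = 505`). [folklore] -/
theorem P5_mul_P101a_twentythree (hθ : aeval θ (csPoly 23) = 0) :
    span {(5 : 𝓞 K), thetaInt hθ - 3} * span {(101 : 𝓞 K), thetaInt hθ - 23} =
      span {thetaInt hθ ^ 2 - thetaInt hθ - 1} := by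
  have rel := thetaInt_rel_twentythree hθ
  set t := thetaInt hθ with ht
  exact span_pair_mul_span_pair_eq_span_singleton
    (δ₁ := t ^ 2 - 483) (δ₂ := -5 * t + 110)
    (δ₃ := 4 * t ^ 2 - 101 * t + 290) (δ₄ := -t ^ 2 + 25 * t - 66)
    (u₁ := 1) (u₂ := 5) (u₃ := 0) (u₄ := 1)
    (by linear_combination (-t - 22) * rel) (by linear_combination (5 : 𝓞 K) * rel)
    (by linear_combination (-4 * t + 13) * rel) (by linear_combination (t - 3) * rel)
    (by ring)

/-- **`𝔭₇ (101, θ - 33) = (3θ + 2)`** (`N = 707`). [folklore] -/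
theorem P7_mul_P101b_twentythree (hθ : aeval θ (csPoly 23) = 0) :
    span {(7 : 𝓞 K), thetaInt hθ - 4} * span {(101 : 𝓞 K), thetaInt hθ - 33} =
      span {3 * thetaInt hθ + 2} := by
  have rel := thetaInt_rel_twentythree hθ
  set t := thetaInt hθ with ht
  exact span_pair_mul_span_pair_eq_span_singleton
    (δ₁ := 9 * t ^ 2 - 213 * t + 340) (δ₂ := -3 * t ^ 2 + 71 * t - 111)
    (δ₃ := -6 * t ^ 2 + 142 * t - 193) (δ₄ := 2 * t ^ 2 - 47 * t + 63)
    (u₁ := -4) (u₂ := -14) (u₃ := 1) (u₄ := 0)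
    (by linear_combination (-27 : 𝓞 K) * rel) (by linear_combination (9 : 𝓞 K) * rel)
    (by linear_combination (18 : 𝓞 K) * rel) (by linear_combination (-6 : 𝓞 K) * rel)
    (by ring)

/-- **`(101, θ - 68) = (3θ - 2)` is principal** (`N(3θ - 2) = -101`). [folklore] -/
theorem P101c_eq_twentythree (hθ : aeval θ (csPoly 23) = 0) :
    span {(101 : 𝓞 K), thetaInt hθ - 68} = span {3 * thetaInt hθ - 2} := by
  have rel := thetaInt_rel_twentythree hθ
  set t := thetaInt hθ with ht
  exact span_pair_eq_span_singleton (u := 2) (v := 3) (δ := -9 * t ^ 2 + 201 * t - 64)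
    (ε := 6 * t ^ 2 - 134 * t + 43)
    (by ring) (by linear_combination (27 : 𝓞 K) * rel) (by linear_combination (-18 : 𝓞 K) * rel)

/-- **`𝔭₁₀₃ = (103, θ - 69) = (3θ - 1)` is principal** (`N(3θ - 1) = -103`). [folklore] -/
theorem P103_eq_twentythree (hθ : aeval θ (csPoly 23) = 0) :
    span {(103 : 𝓞 K), thetaInt hθ - 69} = span {3 * thetaInt hθ - 1} := by
  have rel := thetaInt_rel_twentythree hθ
  set t := thetaInt hθ with ht
  exact span_pair_eq_span_singleton (u := 2) (v := 3) (δ := -9 * t ^ 2 + 204 * t - 130)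
    (ε := 6 * t ^ 2 - 136 * t + 87)
    (by ring) (by linear_combination (27 : 𝓞 K) * rel) (by linear_combination (-18 : 𝓞 K) * rel)

/-- **`𝔭₇ (107, θ - 44) = (5θ - 6)`** (`N = 749`). [folklore] -/
theorem P7_mul_P107a_twentythree (hθ : aeval θ (csPoly 23) = 0) :
    span {(7 : 𝓞 K), thetaInt hθ - 4} * span {(107 : 𝓞 K), thetaInt hθ - 44} =
      span {5 * thetaInt hθ - 6} := by
  have rel := thetaInt_rel_twentythree hθ
  set t := thetaInt hθ with ht
  exact span_pair_mul_span_pair_eq_span_singleton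
    (δ₁ := 25 * t ^ 2 - 545 * t - 104) (δ₂ := -10 * t ^ 2 + 218 * t + 43)
    (δ₃ := -10 * t ^ 2 + 218 * t + 63) (δ₄ := 4 * t ^ 2 - 87 * t - 26)
    (u₁ := 6) (u₂ := 16) (u₃ := -1) (u₄ := 0)
    (by linear_combination (-125 : 𝓞 K) * rel) (by linear_combination (50 : 𝓞 K) * rel)
    (by linear_combination (50 : 𝓞 K) * rel) (by linear_combination (-20 : 𝓞 K) * rel)
    (by ring)

/-- **`𝔭₁₁ (107, θ - 92) = (7θ - 2)`** (`N = -1177`). [folklore] -/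
theorem P11_mul_P107b_twentythree (hθ : aeval θ (csPoly 23) = 0) :
    span {(11 : 𝓞 K), thetaInt hθ - 5} * span {(107 : 𝓞 K), thetaInt hθ - 92} =
      span {7 * thetaInt hθ - 2} := by
  have rel := thetaInt_rel_twentythree hθ
  set t := thetaInt hθ with ht
  exact span_pair_mul_span_pair_eq_span_singleton
    (δ₁ := -49 * t ^ 2 + 1113 * t - 760) (δ₂ := 42 * t ^ 2 - 954 * t + 653)
    (δ₃ := 21 * t ^ 2 - 477 * t + 341) (δ₄ := -18 * t ^ 2 + 409 * t - 293)
    (u₁ := -39) (u₂ := -48) (u₃ := 5) (u₄ := 0)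
    (by linear_combination (343 : 𝓞 K) * rel) (by linear_combination (-294 : 𝓞 K) * rel)
    (by linear_combination (-147 : 𝓞 K) * rel) (by linear_combination (126 : 𝓞 K) * rel)
    (by ring)

/-- **`𝔭₁₁ (107, θ - 101) = (θ + 6)`** (`N = 1177`). [folklore] -/
theorem P11_mul_P107c_twentythree (hθ : aeval θ (csPoly 23) = 0) :
    span {(11 : 𝓞 K), thetaInt hθ - 5} * span {(107 : 𝓞 K), thetaInt hθ - 101} =
      span {thetaInt hθ + 6} := by
  have rel := thetaInt_rel_twentythree hθ
  set t := thetaInt hθ with ht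
  exact span_pair_mul_span_pair_eq_span_singleton
    (δ₁ := t ^ 2 - 29 * t + 196) (δ₂ := -t ^ 2 + 29 * t - 185)
    (δ₃ := -t ^ 2 + 29 * t - 89) (δ₄ := t ^ 2 - 28 * t + 84)
    (u₁ := 35) (u₂ := 39) (u₃ := -4) (u₄ := 0)
    (by linear_combination (-1 : 𝓞 K) * rel) (by linear_combination (1 : 𝓞 K) * rel)
    (by linear_combination (1 : 𝓞 K) * rel) (by linear_combination (-1 : 𝓞 K) * rel)
    (by ring)

/-- **`𝔭₅ 𝔭₁₀₉ = (7θ - 6)`** (`N = -545`). [folklore] -/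
theorem P5_mul_P109_twentythree (hθ : aeval θ (csPoly 23) = 0) :
    span {(5 : 𝓞 K), thetaInt hθ - 3} * span {(109 : 𝓞 K), thetaInt hθ - 32} =
      span {7 * thetaInt hθ - 6} := by
  have rel := thetaInt_rel_twentythree hθ
  set t := thetaInt hθ with ht
  exact span_pair_mul_span_pair_eq_span_singleton
    (δ₁ := -49 * t ^ 2 + 1085 * t - 148) (δ₂ := 14 * t ^ 2 - 310 * t + 43)
    (δ₃ := 21 * t ^ 2 - 465 * t + 79) (δ₄ := -6 * t ^ 2 + 133 * t - 23)
    (u₁ := 12) (u₂ := 45) (u₃ := -2) (u₄ := 0)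
    (by linear_combination (343 : 𝓞 K) * rel) (by linear_combination (-98 : 𝓞 K) * rel)
    (by linear_combination (-147 : 𝓞 K) * rel) (by linear_combination (42 : 𝓞 K) * rel)
    (by ring)

/-- **`𝔭₇ (113, θ - 26) = (9θ - 8)`** (`N = -791`). [folklore] -/
theorem P7_mul_P113a_twentythree (hθ : aeval θ (csPoly 23) = 0) :
    span {(7 : 𝓞 K), thetaInt hθ - 4} * span {(113 : 𝓞 K), thetaInt hθ - 26} =
      span {9 * thetaInt hθ - 8} := by
  have rel := thetaInt_rel_twentythree hθ
  set t := thetaInt hθ with ht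
  exact span_pair_mul_span_pair_eq_span_singleton
    (δ₁ := -81 * t ^ 2 + 1791 * t - 190) (δ₂ := 18 * t ^ 2 - 398 * t + 43)
    (δ₃ := 36 * t ^ 2 - 796 * t + 97) (δ₄ := -8 * t ^ 2 + 177 * t - 22)
    (u₁ := -6) (u₂ := -31) (u₃ := 2) (u₄ := 0)
    (by linear_combination (729 : 𝓞 K) * rel) (by linear_combination (-162 : 𝓞 K) * rel)
    (by linear_combination (-324 : 𝓞 K) * rel) (by linear_combination (72 : 𝓞 K) * rel)
    (by ring)

/-- **`𝔭₇ (113, θ - 45) = (5θ + 1)`** (`N = 791`). [folklore] -/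
theorem P7_mul_P113b_twentythree (hθ : aeval θ (csPoly 23) = 0) :
    span {(7 : 𝓞 K), thetaInt hθ - 4} * span {(113 : 𝓞 K), thetaInt hθ - 45} =
      span {5 * thetaInt hθ + 1} := by
  have rel := thetaInt_rel_twentythree hθ
  set t := thetaInt hθ with ht
  exact span_pair_mul_span_pair_eq_span_singleton
    (δ₁ := 25 * t ^ 2 - 580 * t + 666) (δ₂ := -10 * t ^ 2 + 232 * t - 265)
    (δ₃ := -15 * t ^ 2 + 348 * t - 377) (δ₄ := 6 * t ^ 2 - 139 * t + 150)
    (u₁ := 12) (u₂ := 33) (u₃ := -2) (u₄ := 0)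
    (by linear_combination (-125 : 𝓞 K) * rel) (by linear_combination (50 : 𝓞 K) * rel)
    (by linear_combination (75 : 𝓞 K) * rel) (by linear_combination (-30 : 𝓞 K) * rel)
    (by ring)

/-- **`𝔭₁₃ (113, θ - 65) = (7θ - 3)`** (`N = -1469`). [folklore] -/
theorem P13_mul_P113c_twentythree (hθ : aeval θ (csPoly 23) = 0) :
    span {(13 : 𝓞 K), thetaInt hθ - 6} * span {(113 : 𝓞 K), thetaInt hθ - 65} =
      span {7 * thetaInt hθ - 3} := by
  have rel := thetaInt_rel_twentythree hθ
  set t := thetaInt hθ with ht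
  exact span_pair_mul_span_pair_eq_span_singleton
    (δ₁ := -49 * t ^ 2 + 1106 * t - 604) (δ₂ := 28 * t ^ 2 - 632 * t + 347)
    (δ₃ := 21 * t ^ 2 - 474 * t + 275) (δ₄ := -12 * t ^ 2 + 271 * t - 158)
    (u₁ := 23) (u₂ := 44) (u₃ := -5) (u₄ := 0)
    (by linear_combination (343 : 𝓞 K) * rel) (by linear_combination (-196 : 𝓞 K) * rel)
    (by linear_combination (-147 : 𝓞 K) * rel) (by linear_combination (84 : 𝓞 K) * rel)
    (by ring)


/-! ### The class group is generated by `a = [𝔭₅]`, `a⁵ = 1` -/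

/-- `(5, θ - 3)` is a nonzero ideal. [folklore] -/
theorem P5_mem_nonZeroDivisors_twentythree (hθ : aeval θ (csPoly 23) = 0) :
    span {(5 : 𝓞 K), thetaInt hθ - 3} ∈ (Ideal (𝓞 K))⁰ := by
  have h := span_pair_natCast_mem_nonZeroDivisors (K := K) (n := 5) (by norm_num)
    (thetaInt hθ - 3)
  simp only [Nat.cast_ofNat] at h
  exact h

/-- `(13, θ - 6)` is a nonzero ideal. [folklore] -/
theorem P13_mem_nonZeroDivisors_twentythree (hθ : aeval θ (csPoly 23) = 0) :
    span {(13 : 𝓞 K), thetaInt hθ - 6} ∈ (Ideal (𝓞 K))⁰ := by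
  have h := span_pair_natCast_mem_nonZeroDivisors (K := K) (n := 13) (by norm_num)
    (thetaInt hθ - 6)
  simp only [Nat.cast_ofNat] at h
  exact h

/-- `(11, θ - 5)` is a nonzero ideal. [folklore] -/
theorem P11_mem_nonZeroDivisors_twentythree (hθ : aeval θ (csPoly 23) = 0) :
    span {(11 : 𝓞 K), thetaInt hθ - 5} ∈ (Ideal (𝓞 K))⁰ := by
  have h := span_pair_natCast_mem_nonZeroDivisors (K := K) (n := 11) (by norm_num)
    (thetaInt hθ - 5)
  simp only [Nat.cast_ofNat] at h
  exact h

/-- `(7, θ - 4)` is a nonzero ideal. [folklore] -/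
theorem P7_mem_nonZeroDivisors_twentythree (hθ : aeval θ (csPoly 23) = 0) :
    span {(7 : 𝓞 K), thetaInt hθ - 4} ∈ (Ideal (𝓞 K))⁰ := by
  have h := span_pair_natCast_mem_nonZeroDivisors (K := K) (n := 7) (by norm_num)
    (thetaInt hθ - 4)
  simp only [Nat.cast_ofNat] at h
  exact h

/-- **Every ideal class of the trace `23` field is one of `1`, `[𝔭₅]`, `[𝔭₁₃]`, `[𝔭₁₁]`, `[𝔭₇]`** — the
powers `a⁰, a¹, a², a³, a⁴` of `a = [𝔭₅]`, `𝔭₅ = (5, θ - 3)`, where `a⁵ = 1` because `[𝔭₁₁] = a⁻²`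
(`𝔭₅² = (25, θ - 18)`, `(25, θ - 18) 𝔭₁₁ = (3θ - 4)`), `[𝔭₁₃] = [𝔭₁₁]⁻¹ = a²` (`𝔭₁₁ 𝔭₁₃ = (2θ + 1)`) and
`[𝔭₁₃]² = a⁻¹` (`𝔭₁₃² = (169, θ - 71)`, `𝔭₅ (169, θ - 71) = (θ² - 2θ + 2)`); so the class number divides
`5`. Proof: `d_K = 173857`, `⌊M_K⌋ ≤ 118`, Dedekind–Kummer at `p ≤ 118` (`23 ∣ Δ` ramifies) and the
relations listed in the module docstring. [cite: KimYamada2023, §6.1 (proof of Thm. B)] -/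
theorem classGroup_mem_five_twentythree (hθ : aeval θ (csPoly 23) = 0) (h3 : finrank ℚ K = 3)
    (C : ClassGroup (𝓞 K)) :
    C = 1 ∨ C = ClassGroup.mk0 ⟨span {(5 : 𝓞 K), thetaInt hθ - 3}, P5_mem_nonZeroDivisors_twentythree hθ⟩ ∨
      C = ClassGroup.mk0 ⟨span {(13 : 𝓞 K), thetaInt hθ - 6}, P13_mem_nonZeroDivisors_twentythree hθ⟩ ∨
      C = ClassGroup.mk0 ⟨span {(11 : 𝓞 K), thetaInt hθ - 5}, P11_mem_nonZeroDivisors_twentythree hθ⟩ ∨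
      C = ClassGroup.mk0 ⟨span {(7 : 𝓞 K), thetaInt hθ - 4}, P7_mem_nonZeroDivisors_twentythree hθ⟩ := by
  classical
  have rel := thetaInt_rel_twentythree hθ
  set t := thetaInt hθ with ht
  have hne : ∀ (x y : 𝓞 K) (n : ℕ), x * y = n → n ≠ 0 → x ≠ 0 := by
    rintro x y n hxy hn rfl
    rw [zero_mul] at hxy
    exact hn (by exact_mod_cast hxy.symm)
  have hne1 : 3 * t - 4 ≠ 0 :=
    hne _ (9 * t ^ 2 - 195 * t - 62) 275 (by push_cast; linear_combination (27 : 𝓞 K) * rel)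
      (by norm_num)
  have hne2 : 2 * t + 1 ≠ 0 :=
    hne _ (4 * t ^ 2 - 94 * t + 135) 143 (by push_cast; linear_combination (8 : 𝓞 K) * rel)
      (by norm_num)
  have hne3 : t ^ 2 - 2 * t + 2 ≠ 0 :=
    hne _ (-22 * t ^ 2 + 465 * t + 421) 845 (by push_cast; linear_combination (-22 * t + 3) * rel)
      (by norm_num)
  have hne4 : 2 * t - 1 ≠ 0 :=
    hne _ (-4 * t ^ 2 + 90 * t - 43) 35 (by push_cast; linear_combination (-8 : 𝓞 K) * rel)
      (by norm_num)
  have hne5 : t - 3 ≠ 0 :=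
    hne _ (t ^ 2 - 20 * t - 38) 115 (by push_cast; linear_combination (1 : 𝓞 K) * rel)
      (by norm_num)
  have hne6 : t - 10 ≠ 0 :=
    hne _ (t ^ 2 - 13 * t - 108) 1081 (by push_cast; linear_combination (1 : 𝓞 K) * rel)
      (by norm_num)
  have hne7 : 5 * t - 3 ≠ 0 :=
    hne _ (-25 * t ^ 2 + 560 * t - 214) 517 (by push_cast; linear_combination (-125 : 𝓞 K) * rel)
      (by norm_num)
  have hne8 : t + 2 ≠ 0 :=
    hne _ (t ^ 2 - 25 * t + 72) 145 (by push_cast; linear_combination (1 : 𝓞 K) * rel)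
      (by norm_num)
  have hne9 : t - 4 ≠ 0 :=
    hne _ (t ^ 2 - 19 * t - 54) 217 (by push_cast; linear_combination (1 : 𝓞 K) * rel)
      (by norm_num)
  have hne10 : t - 5 ≠ 0 :=
    hne _ (t ^ 2 - 18 * t - 68) 341 (by push_cast; linear_combination (1 : 𝓞 K) * rel)
      (by norm_num)
  have hne11 : t ^ 2 - 3 * t + 1 ≠ 0 :=
    hne _ (39 * t ^ 2 - 878 * t + 439) 341 (by push_cast; linear_combination (39 * t - 98) * rel)
      (by norm_num)
  have hne12 : t - 6 ≠ 0 :=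
    hne _ (t ^ 2 - 17 * t - 80) 481 (by push_cast; linear_combination (1 : 𝓞 K) * rel)
      (by norm_num)
  have hne13 : t + 3 ≠ 0 :=
    hne _ (t ^ 2 - 26 * t + 100) 301 (by push_cast; linear_combination (1 : 𝓞 K) * rel)
      (by norm_num)
  have hne14 : t ^ 2 - 4 * t + 1 ≠ 0 :=
    hne _ (55 * t ^ 2 - 1247 * t + 813) 611 (by push_cast; linear_combination (55 * t - 202) * rel)
      (by norm_num)
  have hne15 : 3 * t + 1 ≠ 0 :=
    hne _ (9 * t ^ 2 - 210 * t + 268) 295 (by push_cast; linear_combination (27 : 𝓞 K) * rel)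
      (by norm_num)
  have hne16 : 8 * t - 7 ≠ 0 :=
    hne _ (-64 * t ^ 2 + 1416 * t - 169) 671 (by push_cast; linear_combination (-512 : 𝓞 K) * rel)
      (by norm_num)
  have hne17 : t ^ 2 + 2 * t - 2 ≠ 0 :=
    hne _ (-74 * t ^ 2 + 1651 * t - 501) 803 (by push_cast; linear_combination (-74 * t - 199) * rel)
      (by norm_num)
  have hne18 : t - 19 ≠ 0 :=
    hne _ (t ^ 2 - 4 * t - 54) 1027 (by push_cast; linear_combination (1 : 𝓞 K) * rel)
      (by norm_num)
  have hne19 : 11 * t - 1 ≠ 0 :=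
    hne _ (-121 * t ^ 2 + 2772 * t - 2410) 1079 (by push_cast; linear_combination (-1331 : 𝓞 K) * rel)
      (by norm_num)
  have hne20 : t ^ 2 - t - 1 ≠ 0 :=
    hne _ (t ^ 2 - 483) 505 (by push_cast; linear_combination (t + 22) * rel)
      (by norm_num)
  have hne21 : 3 * t + 2 ≠ 0 :=
    hne _ (9 * t ^ 2 - 213 * t + 340) 707 (by push_cast; linear_combination (27 : 𝓞 K) * rel)
      (by norm_num)
  have hne22 : 5 * t - 6 ≠ 0 :=
    hne _ (25 * t ^ 2 - 545 * t - 104) 749 (by push_cast; linear_combination (125 : 𝓞 K) * rel)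
      (by norm_num)
  have hne23 : 7 * t - 2 ≠ 0 :=
    hne _ (-49 * t ^ 2 + 1113 * t - 760) 1177 (by push_cast; linear_combination (-343 : 𝓞 K) * rel)
      (by norm_num)
  have hne24 : t + 6 ≠ 0 :=
    hne _ (t ^ 2 - 29 * t + 196) 1177 (by push_cast; linear_combination (1 : 𝓞 K) * rel)
      (by norm_num)
  have hne25 : 7 * t - 6 ≠ 0 :=
    hne _ (-49 * t ^ 2 + 1085 * t - 148) 545 (by push_cast; linear_combination (-343 : 𝓞 K) * rel)
      (by norm_num)
  have hne26 : 9 * t - 8 ≠ 0 :=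
    hne _ (-81 * t ^ 2 + 1791 * t - 190) 791 (by push_cast; linear_combination (-729 : 𝓞 K) * rel)
      (by norm_num)
  have hne27 : 5 * t + 1 ≠ 0 :=
    hne _ (25 * t ^ 2 - 580 * t + 666) 791 (by push_cast; linear_combination (125 : 𝓞 K) * rel)
      (by norm_num)
  have hne28 : 7 * t - 3 ≠ 0 :=
    hne _ (-49 * t ^ 2 + 1106 * t - 604) 1469 (by push_cast; linear_combination (-343 : 𝓞 K) * rel)
      (by norm_num)
  have hinv : ∀ (P Q : Ideal (𝓞 K)) (hP0 : P ∈ (Ideal (𝓞 K))⁰) (hQ0 : Q ∈ (Ideal (𝓞 K))⁰) (x : 𝓞 K),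
      x ≠ 0 → P * Q = span {x} → ClassGroup.mk0 ⟨P, hP0⟩ = (ClassGroup.mk0 ⟨Q, hQ0⟩)⁻¹ := by
    intro P Q hP0 hQ0 x hx hPQ
    exact ClassGroup.mk0_eq_mk0_inv_iff.mpr ⟨x, hx, by simpa using hPQ⟩
  have hmulcls : ∀ (P Q R : Ideal (𝓞 K)) (hP0 : P ∈ (Ideal (𝓞 K))⁰) (hQ0 : Q ∈ (Ideal (𝓞 K))⁰)
      (hR0 : R ∈ (Ideal (𝓞 K))⁰), P * Q = R →
        ClassGroup.mk0 ⟨P, hP0⟩ * ClassGroup.mk0 ⟨Q, hQ0⟩ = ClassGroup.mk0 ⟨R, hR0⟩ := by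
    intro P Q R hP0 hQ0 hR0 hPQ
    rw [← map_mul]
    congr 1
    exact Subtype.ext (by simpa using hPQ)
  have hnz : ∀ (n : ℕ) (hn : n ≠ 0) (x : 𝓞 K), span {(n : 𝓞 K), x} ∈ (Ideal (𝓞 K))⁰ :=
    fun n hn x => span_pair_natCast_mem_nonZeroDivisors (K := K) hn x
  have hP5 : span {(5 : 𝓞 K), t - 3} ∈ (Ideal (𝓞 K))⁰ := P5_mem_nonZeroDivisors_twentythree hθ
  have hP13 : span {(13 : 𝓞 K), t - 6} ∈ (Ideal (𝓞 K))⁰ := P13_mem_nonZeroDivisors_twentythree hθ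
  have hP11 : span {(11 : 𝓞 K), t - 5} ∈ (Ideal (𝓞 K))⁰ := P11_mem_nonZeroDivisors_twentythree hθ
  have hP7 : span {(7 : 𝓞 K), t - 4} ∈ (Ideal (𝓞 K))⁰ := P7_mem_nonZeroDivisors_twentythree hθ
  have hP25 : span {(25 : 𝓞 K), t - 18} ∈ (Ideal (𝓞 K))⁰ := by
    have h := hnz 25 (by norm_num) (t - 18)
    simp only [Nat.cast_ofNat] at h
    exact h
  have hP169 : span {(169 : 𝓞 K), t - 71} ∈ (Ideal (𝓞 K))⁰ := by
    have h := hnz 169 (by norm_num) (t - 71)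
    simp only [Nat.cast_ofNat] at h
    exact h
  have hP47a : span {(47 : 𝓞 K), t - 10} ∈ (Ideal (𝓞 K))⁰ := by
    have h := hnz 47 (by norm_num) (t - 10)
    simp only [Nat.cast_ofNat] at h
    exact h
  set a : ClassGroup (𝓞 K) := ClassGroup.mk0 ⟨span {(5 : 𝓞 K), t - 3}, hP5⟩ with ha
  have h5cls : ClassGroup.mk0 ⟨span {(5 : 𝓞 K), t - 3}, hP5⟩ = a ^ (1 : ℤ) := by rw [zpow_one]
  have h25cls : ClassGroup.mk0 ⟨span {(25 : 𝓞 K), t - 18}, hP25⟩ = a ^ (2 : ℤ) := by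
    rw [zpow_two, ha, hmulcls _ _ _ hP5 hP5 hP25 (P5_mul_P5_twentythree hθ)]
  have h11cls : ClassGroup.mk0 ⟨span {(11 : 𝓞 K), t - 5}, hP11⟩ = a ^ (-2 : ℤ) := by
    rw [hinv _ _ hP11 hP25 _ hne1 (by rw [mul_comm]; exact P25_mul_P11_twentythree hθ), h25cls, ← zpow_neg]
  have h13cls : ClassGroup.mk0 ⟨span {(13 : 𝓞 K), t - 6}, hP13⟩ = a ^ (2 : ℤ) := by
    rw [hinv _ _ hP13 hP11 _ hne2 (by rw [mul_comm]; exact P11_mul_P13_twentythree hθ), h11cls, ← zpow_neg,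
      neg_neg]
  have h169cls : ClassGroup.mk0 ⟨span {(169 : 𝓞 K), t - 71}, hP169⟩ = a ^ (4 : ℤ) := by
    rw [show (4 : ℤ) = 2 + 2 by norm_num, zpow_add, ← h13cls,
      hmulcls _ _ _ hP13 hP13 hP169 (P13_mul_P13_twentythree hθ)]
  have ha5 : a ^ (5 : ℤ) = 1 := by
    have h : a = (ClassGroup.mk0 ⟨span {(169 : 𝓞 K), t - 71}, hP169⟩)⁻¹ :=
      hinv _ _ hP5 hP169 _ hne3 (P5_mul_P169_twentythree hθ)
    rw [h169cls] at h
    rw [show (5 : ℤ) = 1 + 4 by norm_num, zpow_add, zpow_one]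
    nth_rewrite 1 [h]
    rw [inv_mul_cancel]
  have h7cls : ClassGroup.mk0 ⟨span {(7 : 𝓞 K), t - 4}, hP7⟩ = a ^ (-1 : ℤ) := by
    rw [hinv _ _ hP7 hP5 _ hne4 (by rw [mul_comm]; exact P5_mul_P7_twentythree hθ), h5cls, ← zpow_neg]
  have h47acls : ClassGroup.mk0 ⟨span {(47 : 𝓞 K), t - 10}, hP47a⟩ = a ^ (2 : ℤ) := by
    rw [hinv _ _ hP47a hP11 _ hne7 (by rw [mul_comm]; exact P11_mul_P47a_twentythree hθ), h11cls, ← zpow_neg,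
      neg_neg]
  let H : Subgroup (ClassGroup (𝓞 K)) := Subgroup.zpowers a
  have hprinc : ∀ (P : Ideal (𝓞 K)) (hP0 : P ∈ (Ideal (𝓞 K))⁰) (x : 𝓞 K), P = span {x} →
      ClassGroup.mk0 ⟨P, hP0⟩ ∈ H := by
    intro P hP0 x hPx
    have : ClassGroup.mk0 ⟨P, hP0⟩ = 1 :=
      (ClassGroup.mk0_eq_one_iff hP0).mpr ⟨⟨x, by rw [hPx, submodule_span_eq]⟩⟩
    rw [this]
    exact H.one_mem
  -- Minkowski: `⌊M_K⌋ ≤ 118`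
  have hd : ((|NumberField.discr K| : ℤ) : ℝ) ≤ (173857 : ℕ) := by
    rw [discr_eq_twentythree hθ h3]
    norm_num
  have hfloor := floor_minkowskiBound_le_cubic h3 hd (s := 417) (U := 118) (by norm_num)
    (by norm_num) (by norm_num)
  have htop : H = ⊤ := by
    refine classGroup_subgroup_eq_top_of_primesOver H hfloor fun p hp hprime P hP0 hP hle => ?_
    have hpU : p ≤ 118 := (Finset.mem_Icc.mp hp).2
    have h1p : 1 ≤ p := (Finset.mem_Icc.mp hp).1
    interval_cases p
    · exact absurd hprime (by decide)
    · exact hprinc P hP0 _ (eq_span_of_inert_twentythree hθ h3 (by norm_num) hP)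
    · exact hprinc P hP0 _ (eq_span_of_inert_twentythree hθ h3 (by norm_num) hP)
    · exact absurd hprime (by decide)
    · -- `p = 5`
      rcases eq_P5_or_eq_Q5_twentythree hθ h3 hP with h | h <;> subst h
      · rw [show ClassGroup.mk0 ⟨_, hP0⟩ = ClassGroup.mk0 ⟨_, hP5⟩ from rfl, h5cls]
        exact Subgroup.zpow_mem_zpowers a _
      · rw [hinv _ _ hP0 hP5 5 (by norm_num) (by rw [mul_comm]; exact P5_mul_Q5_twentythree hθ), h5cls, ← zpow_neg]
        exact Subgroup.zpow_mem_zpowers a _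
    · exact absurd hprime (by decide)
    · -- `p = 7`
      rcases eq_P7_or_eq_Q7_twentythree hθ h3 hP with h | h <;> subst h
      · rw [show ClassGroup.mk0 ⟨_, hP0⟩ = ClassGroup.mk0 ⟨_, hP7⟩ from rfl, h7cls]
        exact Subgroup.zpow_mem_zpowers a _
      · rw [hinv _ _ hP0 hP7 7 (by norm_num) (by rw [mul_comm]; exact P7_mul_Q7_twentythree hθ), h7cls, ← zpow_neg]
        exact Subgroup.zpow_mem_zpowers a _
    · exact absurd hprime (by decide)
    · exact absurd hprime (by decide)
    · exact absurd hprime (by decide)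
    · -- `p = 11`
      have h := eq_span_pair_of_unique_root_twentythree hθ h3 (Or.inl ⟨rfl, rfl⟩) hP hle
      simp only [Nat.cast_ofNat, Int.cast_ofNat] at h
      subst h
      rw [show ClassGroup.mk0 ⟨_, hP0⟩ = ClassGroup.mk0 ⟨_, hP11⟩ from rfl, h11cls]
      exact Subgroup.zpow_mem_zpowers a _
    · exact absurd hprime (by decide)
    · -- `p = 13`
      have h := eq_span_pair_of_unique_root_twentythree hθ h3 (Or.inr (Or.inl ⟨rfl, rfl⟩)) hP hle
      simp only [Nat.cast_ofNat, Int.cast_ofNat] at h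
      subst h
      rw [show ClassGroup.mk0 ⟨_, hP0⟩ = ClassGroup.mk0 ⟨_, hP13⟩ from rfl, h13cls]
      exact Subgroup.zpow_mem_zpowers a _
    · exact absurd hprime (by decide)
    · exact absurd hprime (by decide)
    · exact absurd hprime (by decide)
    · exact hprinc P hP0 _ (eq_span_of_inert_twentythree hθ h3 (by norm_num) hP)
    · exact absurd hprime (by decide)
    · exact hprinc P hP0 _ (eq_span_of_inert_twentythree hθ h3 (by norm_num) hP)
    · exact absurd hprime (by decide)
    · exact absurd hprime (by decide)
    · exact absurd hprime (by decide)
    · -- `p = 23` (ramified)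
      rcases eq_P23_twentythree hθ h3 hP with h | h | h <;> subst h
      · rw [hinv _ _ hP0 hP5 _ hne5 (by rw [mul_comm]; exact P5_mul_P23a_twentythree hθ), h5cls, ← zpow_neg]
        exact Subgroup.zpow_mem_zpowers a _
      · rw [hinv _ _ hP0 hP47a _ hne6 (P23b_mul_P47a_twentythree hθ), h47acls, ← zpow_neg]
        exact Subgroup.zpow_mem_zpowers a _
      · rw [hinv _ _ hP0 hP47a _ hne6 (P23b_mul_P47a_twentythree hθ), h47acls, ← zpow_neg]
        exact Subgroup.zpow_mem_zpowers a _
    · exact absurd hprime (by decide)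
    · exact absurd hprime (by decide)
    · exact absurd hprime (by decide)
    · exact absurd hprime (by decide)
    · exact absurd hprime (by decide)
    · -- `p = 29`
      have h := eq_span_pair_of_unique_root_twentythree hθ h3 (Or.inr (Or.inr (Or.inl ⟨rfl, rfl⟩))) hP hle
      simp only [Nat.cast_ofNat, Int.cast_ofNat] at h
      subst h
      rw [hinv _ _ hP0 hP5 _ hne8 (by rw [mul_comm]; exact P5_mul_P29_twentythree hθ), h5cls, ← zpow_neg]
      exact Subgroup.zpow_mem_zpowers a _
    · exact absurd hprime (by decide)
    · -- `p = 31` (splits)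
      rcases eq_P31_twentythree hθ h3 hP with h | h | h <;> subst h
      · rw [hinv _ _ hP0 hP7 _ hne9 (by rw [mul_comm]; exact P7_mul_P31a_twentythree hθ), h7cls, ← zpow_neg]
        exact Subgroup.zpow_mem_zpowers a _
      · rw [hinv _ _ hP0 hP11 _ hne10 (by rw [mul_comm]; exact P11_mul_P31b_twentythree hθ), h11cls, ← zpow_neg]
        exact Subgroup.zpow_mem_zpowers a _
      · rw [hinv _ _ hP0 hP11 _ hne11 (by rw [mul_comm]; exact P11_mul_P31c_twentythree hθ), h11cls, ← zpow_neg]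
        exact Subgroup.zpow_mem_zpowers a _
    · exact absurd hprime (by decide)
    · exact absurd hprime (by decide)
    · exact absurd hprime (by decide)
    · exact absurd hprime (by decide)
    · exact absurd hprime (by decide)
    · -- `p = 37`
      have h := eq_span_pair_of_unique_root_twentythree hθ h3 (Or.inr (Or.inr (Or.inr (Or.inl ⟨rfl, rfl⟩)))) hP hle
      simp only [Nat.cast_ofNat, Int.cast_ofNat] at h
      subst h
      rw [hinv _ _ hP0 hP13 _ hne12 (by rw [mul_comm]; exact P13_mul_P37_twentythree hθ), h13cls, ← zpow_neg]
      exact Subgroup.zpow_mem_zpowers a _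
    · exact absurd hprime (by decide)
    · exact absurd hprime (by decide)
    · exact absurd hprime (by decide)
    · -- `p = 41`
      have h := eq_span_pair_of_unique_root_twentythree hθ h3 (Or.inr (Or.inr (Or.inr (Or.inr (Or.inl ⟨rfl, rfl⟩))))) hP hle
      simp only [Nat.cast_ofNat, Int.cast_ofNat] at h
      subst h
      exact hprinc _ hP0 _ (P41_eq_twentythree hθ)
    · exact absurd hprime (by decide)
    · -- `p = 43`
      have h := eq_span_pair_of_unique_root_twentythree hθ h3 (Or.inr (Or.inr (Or.inr (Or.inr (Or.inr (Or.inl ⟨rfl, rfl⟩)))))) hP hle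
      simp only [Nat.cast_ofNat, Int.cast_ofNat] at h
      subst h
      rw [hinv _ _ hP0 hP7 _ hne13 (by rw [mul_comm]; exact P7_mul_P43_twentythree hθ), h7cls, ← zpow_neg]
      exact Subgroup.zpow_mem_zpowers a _
    · exact absurd hprime (by decide)
    · exact absurd hprime (by decide)
    · exact absurd hprime (by decide)
    · -- `p = 47` (splits)
      rcases eq_P47_twentythree hθ h3 hP with h | h | h <;> subst h
      · rw [show ClassGroup.mk0 ⟨_, hP0⟩ = ClassGroup.mk0 ⟨_, hP47a⟩ from rfl, h47acls]
        exact Subgroup.zpow_mem_zpowers a _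
      · rw [hinv _ _ hP0 hP13 _ hne14 (by rw [mul_comm]; exact P13_mul_P47b_twentythree hθ), h13cls, ← zpow_neg]
        exact Subgroup.zpow_mem_zpowers a _
      · exact hprinc _ hP0 _ (P47c_eq_twentythree hθ)
    · exact absurd hprime (by decide)
    · exact absurd hprime (by decide)
    · exact absurd hprime (by decide)
    · exact absurd hprime (by decide)
    · exact absurd hprime (by decide)
    · exact hprinc P hP0 _ (eq_span_of_inert_twentythree hθ h3 (by norm_num) hP)
    · exact absurd hprime (by decide)
    · exact absurd hprime (by decide)
    · exact absurd hprime (by decide)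
    · exact absurd hprime (by decide)
    · exact absurd hprime (by decide)
    · -- `p = 59`
      have h := eq_span_pair_of_unique_root_twentythree hθ h3 (Or.inr (Or.inr (Or.inr (Or.inr (Or.inr (Or.inr (Or.inl ⟨rfl, rfl⟩))))))) hP hle
      simp only [Nat.cast_ofNat, Int.cast_ofNat] at h
      subst h
      rw [hinv _ _ hP0 hP5 _ hne15 (by rw [mul_comm]; exact P5_mul_P59_twentythree hθ), h5cls, ← zpow_neg]
      exact Subgroup.zpow_mem_zpowers a _
    · exact absurd hprime (by decide)
    · -- `p = 61`
      have h := eq_span_pair_of_unique_root_twentythree hθ h3 (Or.inr (Or.inr (Or.inr (Or.inr (Or.inr (Or.inr (Or.inr (Or.inl ⟨rfl, rfl⟩)))))))) hP hle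
      simp only [Nat.cast_ofNat, Int.cast_ofNat] at h
      subst h
      rw [hinv _ _ hP0 hP11 _ hne16 (by rw [mul_comm]; exact P11_mul_P61_twentythree hθ), h11cls, ← zpow_neg]
      exact Subgroup.zpow_mem_zpowers a _
    · exact absurd hprime (by decide)
    · exact absurd hprime (by decide)
    · exact absurd hprime (by decide)
    · exact absurd hprime (by decide)
    · exact absurd hprime (by decide)
    · exact hprinc P hP0 _ (eq_span_of_inert_twentythree hθ h3 (by norm_num) hP)
    · exact absurd hprime (by decide)
    · exact absurd hprime (by decide)
    · exact absurd hprime (by decide)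
    · exact hprinc P hP0 _ (eq_span_of_inert_twentythree hθ h3 (by norm_num) hP)
    · exact absurd hprime (by decide)
    · -- `p = 73`
      have h := eq_span_pair_of_unique_root_twentythree hθ h3 (Or.inr (Or.inr (Or.inr (Or.inr (Or.inr (Or.inr (Or.inr (Or.inr (Or.inl ⟨rfl, rfl⟩))))))))) hP hle
      simp only [Nat.cast_ofNat, Int.cast_ofNat] at h
      subst h
      rw [hinv _ _ hP0 hP11 _ hne17 (by rw [mul_comm]; exact P11_mul_P73_twentythree hθ), h11cls, ← zpow_neg]
      exact Subgroup.zpow_mem_zpowers a _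
    · exact absurd hprime (by decide)
    · exact absurd hprime (by decide)
    · exact absurd hprime (by decide)
    · exact absurd hprime (by decide)
    · exact absurd hprime (by decide)
    · -- `p = 79`
      have h := eq_span_pair_of_unique_root_twentythree hθ h3 (Or.inr (Or.inr (Or.inr (Or.inr (Or.inr (Or.inr (Or.inr (Or.inr (Or.inr (Or.inl ⟨rfl, rfl⟩)))))))))) hP hle
      simp only [Nat.cast_ofNat, Int.cast_ofNat] at h
      subst h
      rw [hinv _ _ hP0 hP13 _ hne18 (by rw [mul_comm]; exact P13_mul_P79_twentythree hθ), h13cls, ← zpow_neg]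
      exact Subgroup.zpow_mem_zpowers a _
    · exact absurd hprime (by decide)
    · exact absurd hprime (by decide)
    · exact absurd hprime (by decide)
    · -- `p = 83`
      have h := eq_span_pair_of_unique_root_twentythree hθ h3 (Or.inr (Or.inr (Or.inr (Or.inr (Or.inr (Or.inr (Or.inr (Or.inr (Or.inr (Or.inr (Or.inl ⟨rfl, rfl⟩))))))))))) hP hle
      simp only [Nat.cast_ofNat, Int.cast_ofNat] at h
      subst h
      rw [hinv _ _ hP0 hP13 _ hne19 (by rw [mul_comm]; exact P13_mul_P83_twentythree hθ), h13cls, ← zpow_neg]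
      exact Subgroup.zpow_mem_zpowers a _
    · exact absurd hprime (by decide)
    · exact absurd hprime (by decide)
    · exact absurd hprime (by decide)
    · exact absurd hprime (by decide)
    · exact absurd hprime (by decide)
    · exact hprinc P hP0 _ (eq_span_of_inert_twentythree hθ h3 (by norm_num) hP)
    · exact absurd hprime (by decide)
    · exact absurd hprime (by decide)
    · exact absurd hprime (by decide)
    · exact absurd hprime (by decide)
    · exact absurd hprime (by decide)
    · exact absurd hprime (by decide)
    · exact absurd hprime (by decide)
    · exact hprinc P hP0 _ (eq_span_of_inert_twentythree hθ h3 (by norm_num) hP)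
    · exact absurd hprime (by decide)
    · exact absurd hprime (by decide)
    · exact absurd hprime (by decide)
    · -- `p = 101` (splits)
      rcases eq_P101_twentythree hθ h3 hP with h | h | h <;> subst h
      · rw [hinv _ _ hP0 hP5 _ hne20 (by rw [mul_comm]; exact P5_mul_P101a_twentythree hθ), h5cls, ← zpow_neg]
        exact Subgroup.zpow_mem_zpowers a _
      · rw [hinv _ _ hP0 hP7 _ hne21 (by rw [mul_comm]; exact P7_mul_P101b_twentythree hθ), h7cls, ← zpow_neg]
        exact Subgroup.zpow_mem_zpowers a _
      · exact hprinc _ hP0 _ (P101c_eq_twentythree hθ)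
    · exact absurd hprime (by decide)
    · -- `p = 103`
      have h := eq_span_pair_of_unique_root_twentythree hθ h3 (Or.inr (Or.inr (Or.inr (Or.inr (Or.inr (Or.inr (Or.inr (Or.inr (Or.inr (Or.inr (Or.inr (Or.inl ⟨rfl, rfl⟩)))))))))))) hP hle
      simp only [Nat.cast_ofNat, Int.cast_ofNat] at h
      subst h
      exact hprinc _ hP0 _ (P103_eq_twentythree hθ)
    · exact absurd hprime (by decide)
    · exact absurd hprime (by decide)
    · exact absurd hprime (by decide)
    · -- `p = 107` (splits)
      rcases eq_P107_twentythree hθ h3 hP with h | h | h <;> subst h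
      · rw [hinv _ _ hP0 hP7 _ hne22 (by rw [mul_comm]; exact P7_mul_P107a_twentythree hθ), h7cls, ← zpow_neg]
        exact Subgroup.zpow_mem_zpowers a _
      · rw [hinv _ _ hP0 hP11 _ hne23 (by rw [mul_comm]; exact P11_mul_P107b_twentythree hθ), h11cls, ← zpow_neg]
        exact Subgroup.zpow_mem_zpowers a _
      · rw [hinv _ _ hP0 hP11 _ hne24 (by rw [mul_comm]; exact P11_mul_P107c_twentythree hθ), h11cls, ← zpow_neg]
        exact Subgroup.zpow_mem_zpowers a _
    · exact absurd hprime (by decide)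
    · -- `p = 109`
      have h := eq_span_pair_of_unique_root_twentythree hθ h3 (Or.inr (Or.inr (Or.inr (Or.inr (Or.inr (Or.inr (Or.inr (Or.inr (Or.inr (Or.inr (Or.inr (Or.inr (⟨rfl, rfl⟩))))))))))))) hP hle
      simp only [Nat.cast_ofNat, Int.cast_ofNat] at h
      subst h
      rw [hinv _ _ hP0 hP5 _ hne25 (by rw [mul_comm]; exact P5_mul_P109_twentythree hθ), h5cls, ← zpow_neg]
      exact Subgroup.zpow_mem_zpowers a _
    · exact absurd hprime (by decide)
    · exact absurd hprime (by decide)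
    · exact absurd hprime (by decide)
    · -- `p = 113` (splits)
      rcases eq_P113_twentythree hθ h3 hP with h | h | h <;> subst h
      · rw [hinv _ _ hP0 hP7 _ hne26 (by rw [mul_comm]; exact P7_mul_P113a_twentythree hθ), h7cls, ← zpow_neg]
        exact Subgroup.zpow_mem_zpowers a _
      · rw [hinv _ _ hP0 hP7 _ hne27 (by rw [mul_comm]; exact P7_mul_P113b_twentythree hθ), h7cls, ← zpow_neg]
        exact Subgroup.zpow_mem_zpowers a _
      · rw [hinv _ _ hP0 hP13 _ hne28 (by rw [mul_comm]; exact P13_mul_P113c_twentythree hθ), h13cls, ← zpow_neg]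
        exact Subgroup.zpow_mem_zpowers a _
    · exact absurd hprime (by decide)
    · exact absurd hprime (by decide)
    · exact absurd hprime (by decide)
    · exact absurd hprime (by decide)
    · exact absurd hprime (by decide)
  have hC : C ∈ H := by rw [htop]; exact Subgroup.mem_top C
  obtain ⟨k, rfl⟩ := Subgroup.mem_zpowers_iff.mp hC
  obtain ⟨q, r, hr, rfl⟩ : ∃ q r : ℤ, (r = 0 ∨ r = 1 ∨ r = 2 ∨ r = 3 ∨ r = 4) ∧ k = 5 * q + r :=
    ⟨k / 5, k % 5, by omega, by omega⟩
  rw [zpow_add, zpow_mul, ha5, one_zpow, one_mul]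
  rcases hr with rfl | rfl | rfl | rfl | rfl
  · exact Or.inl (zpow_zero a)
  · right; left
    rw [zpow_one]
  · right; right; left
    rw [← h13cls]
  · right; right; right; left
    rw [show (3 : ℤ) = -2 + 5 by norm_num, zpow_add, ha5, mul_one, ← h11cls]
  · right; right; right; right
    rw [show (4 : ℤ) = -1 + 5 by norm_num, zpow_add, ha5, mul_one, ← h7cls]


end Field


/-! ### The ideal classes of `ℤ[X]/(f₂₃)` and Gompf's conjecture for the traces `23` and `-18` -/

section Matrices

/-- **The ideal classes of `ℤ[Θ₂₃] = ℤ[X]/(f₂₃)`**: every non-zero ideal is in the class of one of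
`⟨Θ - 1, 1⟩`, `⟨Θ - 3, 5⟩`, `⟨Θ - 6, 13⟩`, `⟨Θ - 5, 11⟩`, `⟨Θ - 4, 7⟩` (these representatives cover `C(ℤ[Θ₂₃])`). [cite: KimYamada2023, §6.1 (proof of Thm. B)] -/
theorem ideal_class_adjoinRoot_twentythree (J : Ideal (AdjoinRoot (csPoly 23))) (hJ : J ≠ ⊥) :
    ∃ x y : AdjoinRoot (csPoly 23), x ≠ 0 ∧ y ≠ 0 ∧
      (span {x} * J = span {y} * csIdeal 1 1 23 ∨ span {x} * J = span {y} * csIdeal 3 5 23 ∨ span {x} * J = span {y} * csIdeal 6 13 23 ∨ span {x} * J = span {y} * csIdeal 5 11 23 ∨ span {x} * J = span {y} * csIdeal 4 7 23) := by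
  classical
  set θ' := AdjoinRoot.root (csPolyQ 23) with hθ'
  have hθ : aeval θ' (csPoly 23) = 0 := aeval_root_csPoly 23
  have h3 : finrank ℚ (CSField 23) = 3 := finrank_CSField 23
  obtain ⟨e, he⟩ := exists_ringEquiv_adjoinRoot_of_sq hθ h3 csDisc_twentythree_sq
  set I : Ideal (𝓞 (CSField 23)) := J.map e with hI
  have hIJ : I.map (e.symm : 𝓞 (CSField 23) →+* AdjoinRoot (csPoly 23)) = J := by
    rw [hI]
    exact Ideal.map_of_equiv e (I := J)
  have hI0 : I ≠ ⊥ := by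
    intro h0
    apply hJ
    rw [← hIJ, h0, Ideal.map_bot]
  have hImem : I ∈ (Ideal (𝓞 (CSField 23)))⁰ := mem_nonZeroDivisors_iff_ne_zero.mpr hI0
  have hsymm : ∀ x, (e.symm : 𝓞 (CSField 23) →+* AdjoinRoot (csPoly 23)) (e x) = x :=
    fun x => e.symm_apply_apply x
  have hP5 : (span {(5 : 𝓞 (CSField 23)), thetaInt hθ - 3}).map
      (e.symm : 𝓞 (CSField 23) →+* AdjoinRoot (csPoly 23)) = csIdeal 3 5 23 := by
    rw [Ideal.map_span, Set.image_insert_eq, Set.image_singleton, map_sub, ← he, hsymm, map_ofNat,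
      map_ofNat, csIdeal, Set.pair_comm]
    simp
  have hP13 : (span {(13 : 𝓞 (CSField 23)), thetaInt hθ - 6}).map
      (e.symm : 𝓞 (CSField 23) →+* AdjoinRoot (csPoly 23)) = csIdeal 6 13 23 := by
    rw [Ideal.map_span, Set.image_insert_eq, Set.image_singleton, map_sub, ← he, hsymm, map_ofNat,
      map_ofNat, csIdeal, Set.pair_comm]
    simp
  have hP11 : (span {(11 : 𝓞 (CSField 23)), thetaInt hθ - 5}).map
      (e.symm : 𝓞 (CSField 23) →+* AdjoinRoot (csPoly 23)) = csIdeal 5 11 23 := by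
    rw [Ideal.map_span, Set.image_insert_eq, Set.image_singleton, map_sub, ← he, hsymm, map_ofNat,
      map_ofNat, csIdeal, Set.pair_comm]
    simp
  have hP7 : (span {(7 : 𝓞 (CSField 23)), thetaInt hθ - 4}).map
      (e.symm : 𝓞 (CSField 23) →+* AdjoinRoot (csPoly 23)) = csIdeal 4 7 23 := by
    rw [Ideal.map_span, Set.image_insert_eq, Set.image_singleton, map_sub, ← he, hsymm, map_ofNat,
      map_ofNat, csIdeal, Set.pair_comm]
    simp
  have hcase : ∀ (P : Ideal (𝓞 (CSField 23))) (hP0 : P ∈ (Ideal (𝓞 (CSField 23)))⁰)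
      (Q : Ideal (AdjoinRoot (csPoly 23))),
      P.map (e.symm : 𝓞 (CSField 23) →+* AdjoinRoot (csPoly 23)) = Q →
      ClassGroup.mk0 ⟨I, hImem⟩ = ClassGroup.mk0 ⟨P, hP0⟩ →
        ∃ x y : AdjoinRoot (csPoly 23), x ≠ 0 ∧ y ≠ 0 ∧ span {x} * J = span {y} * Q := by
    intro P hP0 Q hPQ hcls
    obtain ⟨x, y, hx, hy, hxy⟩ := ClassGroup.mk0_eq_mk0_iff.mp hcls
    refine ⟨(e.symm : 𝓞 (CSField 23) →+* AdjoinRoot (csPoly 23)) x,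
      (e.symm : 𝓞 (CSField 23) →+* AdjoinRoot (csPoly 23)) y,
      (map_ne_zero_iff _ e.symm.injective).mpr hx, (map_ne_zero_iff _ e.symm.injective).mpr hy, ?_⟩
    have h := congrArg (Ideal.map (e.symm : 𝓞 (CSField 23) →+* AdjoinRoot (csPoly 23))) hxy
    simp only [Ideal.map_mul, Ideal.map_span, Set.image_singleton] at h
    rw [hIJ, hPQ] at h
    exact h
  rcases classGroup_mem_five_twentythree hθ h3 (ClassGroup.mk0 ⟨I, hImem⟩) with h1 | hcl | hcl | hcl | hcl
  · obtain ⟨z, hz⟩ := ((ClassGroup.mk0_eq_one_iff hImem).mp h1).principal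
    have hz' : I = span {z} := by rw [hz, submodule_span_eq]
    have hz0 : z ≠ 0 := by
      rintro rfl
      apply hI0
      rw [hz', Ideal.span_singleton_eq_bot]
    refine ⟨1, (e.symm : 𝓞 (CSField 23) →+* AdjoinRoot (csPoly 23)) z, one_ne_zero,
      (map_ne_zero_iff _ e.symm.injective).mpr hz0, Or.inl ?_⟩
    rw [Ideal.span_singleton_one, Ideal.top_mul, csIdeal_one_one, Ideal.mul_top, ← hIJ, hz',
      Ideal.map_span, Set.image_singleton]
  · obtain ⟨x, y, hx, hy, h⟩ := hcase _ _ _ hP5 hcl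
    exact ⟨x, y, hx, hy, Or.inr (Or.inl h)⟩
  · obtain ⟨x, y, hx, hy, h⟩ := hcase _ _ _ hP13 hcl
    exact ⟨x, y, hx, hy, Or.inr (Or.inr (Or.inl h))⟩
  · obtain ⟨x, y, hx, hy, h⟩ := hcase _ _ _ hP11 hcl
    exact ⟨x, y, hx, hy, Or.inr (Or.inr (Or.inr (Or.inl h)))⟩
  · obtain ⟨x, y, hx, hy, h⟩ := hcase _ _ _ hP7 hcl
    exact ⟨x, y, hx, hy, Or.inr (Or.inr (Or.inr (Or.inr (h))))⟩

/-- `5 ∣ f₂₃(3)`: `(3, 5, 23) ∈ 𝒞𝒮`. [cite: KimYamada2023, §6.1 (proof of Thm. B)] -/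
theorem rep0_dvd_eval_csPoly_twentythree : (5 : ℤ) ∣ (csPoly 23).eval 3 := by
  rw [eval_csPoly]; norm_num

/-- `13 ∣ f₂₃(6)`: `(6, 13, 23) ∈ 𝒞𝒮`. [cite: KimYamada2023, §6.1 (proof of Thm. B)] -/
theorem rep1_dvd_eval_csPoly_twentythree : (13 : ℤ) ∣ (csPoly 23).eval 6 := by
  rw [eval_csPoly]; norm_num

/-- `11 ∣ f₂₃(5)`: `(5, 11, 23) ∈ 𝒞𝒮`. [cite: KimYamada2023, §6.1 (proof of Thm. B)] -/
theorem rep2_dvd_eval_csPoly_twentythree : (11 : ℤ) ∣ (csPoly 23).eval 5 := by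
  rw [eval_csPoly]; norm_num

/-- `7 ∣ f₂₃(4)`: `(4, 7, 23) ∈ 𝒞𝒮`. [cite: KimYamada2023, §6.1 (proof of Thm. B)] -/
theorem rep3_dvd_eval_csPoly_twentythree : (7 : ℤ) ∣ (csPoly 23).eval 4 := by
  rw [eval_csPoly]; norm_num

/-- **Every Cappell–Shaneson matrix of trace `23` is similar to one of 5 standard matrices**
(Prop. 2.14). [cite: KimYamada2023, §6.1 (proof of Thm. B) and Prop. 2.14] -/
theorem isConj_standardCSMatrix_of_trace_eq_twentythree (A : SL(3, ℤ))
    (hdet : ((A : Matrix (Fin 3) (Fin 3) ℤ) - 1).det = 1)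
    (htr : Matrix.trace (A : Matrix (Fin 3) (Fin 3) ℤ) = 23) :
    IsConj A (standardCSMatrix 1 1 23 (one_dvd _)) ∨
      IsConj A (standardCSMatrix 3 5 23 rep0_dvd_eval_csPoly_twentythree) ∨
      IsConj A (standardCSMatrix 6 13 23 rep1_dvd_eval_csPoly_twentythree) ∨
      IsConj A (standardCSMatrix 5 11 23 rep2_dvd_eval_csPoly_twentythree) ∨
      IsConj A (standardCSMatrix 4 7 23 rep3_dvd_eval_csPoly_twentythree) := by
  have hcover : ∀ J : Ideal (AdjoinRoot (csPoly 23)), J ≠ ⊥ →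
      ∃ (c d : ℤ) (_ : d ∣ (csPoly 23).eval c) (x y : AdjoinRoot (csPoly 23)),
        x ≠ 0 ∧ y ≠ 0 ∧ Ideal.span {x} * J = Ideal.span {y} * csIdeal c d 23 ∧
          ((c = 1 ∧ d = 1) ∨ (c = 3 ∧ d = 5) ∨ (c = 6 ∧ d = 13) ∨ (c = 5 ∧ d = 11) ∨ (c = 4 ∧ d = 7)) := by
    intro J hJ
    obtain ⟨x, y, hx, hy, hxy⟩ := ideal_class_adjoinRoot_twentythree J hJ
    rcases hxy with h0 | h1 | h2 | h3 | h4
    · exact ⟨1, 1, one_dvd _, x, y, hx, hy, h0, Or.inl ⟨rfl, rfl⟩⟩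
    · exact ⟨3, 5, rep0_dvd_eval_csPoly_twentythree, x, y, hx, hy, h1, Or.inr (Or.inl ⟨rfl, rfl⟩)⟩
    · exact ⟨6, 13, rep1_dvd_eval_csPoly_twentythree, x, y, hx, hy, h2, Or.inr (Or.inr (Or.inl ⟨rfl, rfl⟩))⟩
    · exact ⟨5, 11, rep2_dvd_eval_csPoly_twentythree, x, y, hx, hy, h3, Or.inr (Or.inr (Or.inr (Or.inl ⟨rfl, rfl⟩)))⟩
    · exact ⟨4, 7, rep3_dvd_eval_csPoly_twentythree, x, y, hx, hy, h4, Or.inr (Or.inr (Or.inr (Or.inr (⟨rfl, rfl⟩))))⟩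
  obtain ⟨c, d, h, hconj, hcd⟩ := exists_isConj_standardCSMatrix_of_cover _ hcover A hdet htr
  rcases hcd with ⟨rfl, rfl⟩ | ⟨rfl, rfl⟩ | ⟨rfl, rfl⟩ | ⟨rfl, rfl⟩ | ⟨rfl, rfl⟩
  · exact Or.inl hconj
  · exact Or.inr (Or.inl hconj)
  · exact Or.inr (Or.inr (Or.inl hconj))
  · exact Or.inr (Or.inr (Or.inr (Or.inl hconj)))
  · exact Or.inr (Or.inr (Or.inr (Or.inr (hconj))))

/-- **Kim–Yamada 2023, Theorem B for the trace `23`, PROVED**: the non-trivial classes move by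
Gompf moves to the traces `8 = 23 - 3·5`, `10 = 23 - 13`, `1 = 23 - 2·11`, `9 = 23 - 2·7`, where Gompf's conjecture holds. [cite: KimYamada2023, Thm. B and §6.1] -/
theorem gompfConjectureForTrace_twentythree : GompfConjectureForTrace 23 := by
  intro A hdet htr
  rcases isConj_standardCSMatrix_of_trace_eq_twentythree A hdet htr with h0 | h1 | h2 | h3 | h4
  · exact (GompfEquiv.of_isConj h0).trans (gompfEquiv_standardCSMatrix_one_one 21 (one_dvd _))
  · exact (GompfEquiv.of_isConj h1).trans
      (gompfEquiv_standardCSMatrix_akbulutKirbyMatrix_of_modEq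
        (gompfConjectureForTrace_of_mem_Icc (by norm_num)) rep0_dvd_eval_csPoly_twentythree
        (show (23 : ℤ) ≡ 8 [ZMOD 5] by decide))
  · exact (GompfEquiv.of_isConj h2).trans
      (gompfEquiv_standardCSMatrix_akbulutKirbyMatrix_of_modEq
        (gompfConjectureForTrace_ten_of aitchisonRubinstein1984_traceNegFiveClasses_holds) rep1_dvd_eval_csPoly_twentythree
        (show (23 : ℤ) ≡ 10 [ZMOD 13] by decide))
  · exact (GompfEquiv.of_isConj h3).trans
      (gompfEquiv_standardCSMatrix_akbulutKirbyMatrix_of_modEq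
        (gompfConjectureForTrace_of_mem_Icc (by norm_num)) rep2_dvd_eval_csPoly_twentythree
        (show (23 : ℤ) ≡ 1 [ZMOD 11] by decide))
  · exact (GompfEquiv.of_isConj h4).trans
      (gompfEquiv_standardCSMatrix_akbulutKirbyMatrix_of_modEq
        (gompfConjectureForTrace_of_mem_Icc (by norm_num)) rep3_dvd_eval_csPoly_twentythree
        (show (23 : ℤ) ≡ 9 [ZMOD 7] by decide))

/-- **Theorem B for the trace `-18`** (`= 5 - 23`), by Theorem A. [cite: KimYamada2023, Thm. A and Thm. B] -/
theorem gompfConjectureForTrace_neg_eighteen : GompfConjectureForTrace (-18) := by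
  have h := gompfConjectureForTrace_of_five_sub gompfConjectureForTrace_twentythree
  norm_num at h
  exact h

end Matrices


end Literature.Topology.FourManifolds

end
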